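import Summits.ValiantsHypothesis.ValiantsHypothesis.Theorems.NNDivisionHard.Negative.WeakReliefBlindPermutahedron
import Literature.Combinatorics.Optimization.PatternMatrixRankUpperBounds
import Literature.Combinatorics.Optimization.UdisjShiftNonnegativeRank
import Literature.Combinatorics.Optimization.SymmetricLpVersusSheraliAdams

/-!
# RealLambda39 — the located permutahedron pencil `Q^Π_λ` is clique-blind at EVERY fixed real `λ > 0`, clique-VISIBLE once `λ·log² n → 0`, and for ROW-SYMMETRIC certificates visible iff `λ → 0` (§7)
# (crux `FifoMatching.NNDivisionHard`, stmt-ValiantsHypothesis-21181; crux WORKFILE of val-idea-39 g5, W7 S2 lane; memo `RealLambda39.md`)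

THEOREM T1 of the memo, kernel version (uniform strategy, degree `2T` for any natural `T` with `λT ≥ 2`):
for every real `λ > 0`, every `n`, every row `a ⊆ [n]` and every column `(b, π)`,
`(1 − |a∩b|)² + λ·inv(a;π) = Σ_s U a s · V (b,π) s` with `U, V ≥ 0` over the slot type `Fin (n+1) × (Finset (Fin n) × Finset (Fin n))`,
where the row factor `U a (k, S, T′) = [|a| = k]·[|S|+|T′| ≤ 2T]·[S ⊆ a][T′ ∩ a = ∅]` is a CONJUNCTION OF AT MOST `2T` LITERALS — so at most
`(n+1)·Σ_{d ≤ 2T} 2^d·C(n,d) = n^{O(1/λ)}` slots are live: the clique rows are blind to `Q^Π_λ` at every constant dilation, there is no `λ_c > 0`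
(S2 of `SmallLambda39.md` §6).  The integer theorem of record (`WeakReliefBlind39.lean` §5 / Negative-lane `inv_rankPlus_le`, `λ ≥ 1`, `O(n³)`)
is the small-degree end of the same picture.  THEOREM T2 of the memo (kernel, §4): the degree-`D` certificate of this FAMILY fails on the
`k`-slice of the column `b = π⁻¹{k, …, k+m−1}` whenever `λ·m² < m − D` (`slice_cone_lower`; `m = 2D`: `λ_D ≥ 1/(4D)`, `slice_cone_lower_quarter`),
while degree `2T` succeeds for every column when `λT ≥ 2` (`slice_cone_upper`): the certificate degree `D(λ)` satisfies `1/(4λ) < D(λ) ≤ 2⌈2/λ⌉`.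

STRUCTURE.  §1 `InCone D f`: the cone of nonnegative real combinations of conjunctions of `≤ D` literals, as an inductive predicate on row
functions `Finset (Fin n) → ℝ`; closure under sums, nonnegative scaling, multiplication by a literal, CONDITIONING, and coefficient extraction.
§2 the cube polynomials `cubeF` (`e = 0`) / `cubeT` (`e = 1`) with per-element reliefs, Fact 1, the two conditioning identities, the FAR BASE
(symmetric relief identity `t(1−s−u)² = −(t−2)(t−s) + (t−1)(s²−s) + (t−s)(t−s−1) + t(u²−2u+2su)`), and the UNIFORM CUBE THEOREM
`InCone (|N|+2) (cubeF …)` when reliefs are `≥ 1` off `N`.  §3 slice transfer: identities I1/I2 (`inv_I1`, `inv_I2`) for a general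
permutation on the slice `|a| = k`, the column identity `col_eq` (column = cube polynomial with reliefs `(λ/2)·dist` + explicit degree-2
slack), the near-set bound `near_card` (`≤ 2T − 2` elements at distance `< 2/λ`), `col_inCone` (degree `2T`) and the packaging
`real_rankPlus_le` (MAIN THEOREM of §3).  §4 the swap functional `swapFn` (`(D − m)·f(P) + Σ_j f(P − x_j + y_j)`), its nonnegativity on
`cone_D` (`swapFn_nonneg_of_inCone`), the closed form `inv(a;π) = Σ_{l∈a} π(l) − (|a|²−|a|)/2` (`inv_closed`), and T2
(`slice_cone_lower`, `slice_cone_lower_quarter`, `slice_cone_upper`).  §5 the same bound in the TREE'S CURRENCY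
`Literature.Combinatorics.Optimization.HasNonnegFactorization` with an explicit polynomial: `hasNonnegFactorization_pencil_poly :
HasNonnegFactorization (pencil n λ) ((n+1)^(4T+1))` for `λT ≥ 2` (live slots inject into `Fin (n+1) × {S // |S| ≤ 2T}²`, `#{S : |S| ≤ D} ≤ (n+1)^D`).
§6 (T3, the OTHER SIDE in the `λ(n)` scale): averaging the two columns `(b̂, id)`, `(b̂, rev_{2m})` on the paired rows
`â = {2i : i ∈ a} ∪ {2i+1 : i ∉ a}` turns any nonnegative factorisation of `M_λ` into one, through the same slots, of the `ρ`-extension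
`(1 − |a∩b|)² + λm²/2` of `UDISJ_m` (`inv(â;id) + inv(â;rev) = m²`), and the tree's DISCHARGED Braun–Fiorini–Pokutta–Steurer 2012 Theorem 5
(`Literature.Combinatorics.Optimization.udisjShift_nonnegRank_explicit`) gives ★★★ `pencil_visible : 2m ≤ n → 4k+3 ≤ m → 0 ≤ λ → λ·m² ≤ 2 →
(nonneg factorisation of pencil n λ through S) → e^{(k+1)/576} ≤ 64(k+1)|S|` and `pencil_visible_rank` (currency form): `rank₊ M_λ^{(n)} ≥
2^{Ω(min(n, λ^{−1/2}))}` — superpolynomial as soon as `λ·log² n → 0`.  So S2's visibility threshold EXISTS as a function `λ*(n) → 0` and lies in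
`[c/log² n, O(1)]`; inside that window the status is open (T1 gives `n^{O(1/λ)}`, T3 gives `2^{Ω(λ^{−1/2})}`).
REV 5 (2026-08-29): §1–§6 complete, no `sorry`; axioms of `pencil_visible` = [propext, Classical.choice, Quot.sound].
§7 (T4, REV 6): for ROW-SYMMETRIC certificates (every `σ ∈ S_n` on rows compensated by a slot permutation — Yannakakis' symmetric case; T1's
certificate is one, `pencil_symm_upper`) the window is CLOSED: by the tree's PROVED Chan–Lee–Raghavendra–Steurer Lemma 4.2 (Dixon–Mortimer 5.2B)
fewer than `C(n, D+1)` symmetric slots make every row function a `(≤ D)`-junta-plus-size function, hence every column a member of `cone_D` on the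
`2D`-slice, which T2 forbids below `λ = 1/(4D)`: ★★★ `pencil_symm_lower : … RowSymmetric U → λ < 1/(4D) → C(n, D+1) ≤ |S|` — symmetric
`rank₊ M_λ = n^{Θ(min(n, 1/λ))}`, superpolynomial IFF `λ → 0`; the residual window concerns asymmetric slots only.  Axioms of `pencil_symm_lower` = std.
VP ≠ VNP is NOT proved; the crux `NNDivisionHard` stays OPEN; nothing here bears on its status (census: one certificate family, made quantitative).
-/

-- the mandated summit-side namespace repeats a component by design (single-problem summit)
set_option linter.dupNamespace false

namespace Summit.ValiantsHypothesis.ValiantsHypothesis.Cruxes.NNDivisionHard.RealLambda39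

open Finset
open Summit.ValiantsHypothesis.Theorems.NNDivisionHardNegative.BlindCubeIdentity (ind ind_nonneg ind_le_one ind_mul_self sum_ind sum_ind_mul)
open Summit.ValiantsHypothesis.Theorems.NNDivisionHardNegative.WeakReliefBlind (posLT invInd inv card_posLT)

noncomputable section

variable {n : ℕ}

/-! ## §1 The conjunction cone -/

/-- real `0/1` indicator `X_e(a) = [e ∈ a]` -/
def X (a : Finset (Fin n)) (e : Fin n) : ℝ := if e ∈ a then 1 else 0

/-- the conjunction slot `[S ⊆ a]·[T ∩ a = ∅]` -/
def cj (S T : Finset (Fin n)) (a : Finset (Fin n)) : ℝ := if S ⊆ a ∧ Disjoint T a then 1 else 0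

theorem X_nonneg (a : Finset (Fin n)) (e : Fin n) : 0 ≤ X a e := by
  unfold X; split_ifs <;> norm_num

theorem X_le_one (a : Finset (Fin n)) (e : Fin n) : X a e ≤ 1 := by
  unfold X; split_ifs <;> norm_num

theorem X_mul_self (a : Finset (Fin n)) (e : Fin n) : X a e * X a e = X a e := by
  unfold X; split_ifs <;> norm_num

theorem cj_nonneg (S T a : Finset (Fin n)) : 0 ≤ cj S T a := by
  unfold cj; split_ifs <;> norm_num

/-- `Σ_{e ∈ b} X_e(a) = |a ∩ b|` -/
theorem sum_X (a b : Finset (Fin n)) : ∑ e ∈ b, X a e = ((a ∩ b).card : ℝ) := by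
  classical
  unfold X
  rw [Finset.sum_boole]
  congr 2
  ext e; simp [Finset.mem_inter, and_comm]

/-- the cone of conjunctions of at most `D` literals: nonnegative real combinations, as an inductive predicate -/
inductive InCone : ℕ → (Finset (Fin n) → ℝ) → Prop
  | atom {D : ℕ} {w : ℝ} {S T : Finset (Fin n)} (hw : 0 ≤ w) (hST : S.card + T.card ≤ D) :
      InCone D (fun a => w * cj S T a)
  | add {D : ℕ} {f g : Finset (Fin n) → ℝ} : InCone D f → InCone D g → InCone D (fun a => f a + g a)

namespace InCone

theorem congr {D : ℕ} {f g : Finset (Fin n) → ℝ} (hf : InCone D f) (h : ∀ a, f a = g a) : InCone D g := by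
  have hfg : f = g := funext h
  exact hfg ▸ hf

theorem mono {D D' : ℕ} {f : Finset (Fin n) → ℝ} (hf : InCone D f) (hD : D ≤ D') : InCone D' f := by
  induction hf with
  | atom hw hST => exact InCone.atom hw (hST.trans hD)
  | add _ _ ihf ihg => exact InCone.add ihf ihg

theorem const (D : ℕ) {w : ℝ} (hw : 0 ≤ w) : InCone D (fun _ : Finset (Fin n) => w) := by
  have h := InCone.atom (n := n) (D := D) (S := ∅) (T := ∅) hw (by simp)
  exact h.congr (fun a => by simp [cj])

theorem smul {D : ℕ} {f : Finset (Fin n) → ℝ} {w : ℝ} (hw : 0 ≤ w) (hf : InCone D f) :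
    InCone D (fun a => w * f a) := by
  induction hf with
  | atom hw' hST => exact (InCone.atom (mul_nonneg hw hw') hST).congr (fun a => by ring)
  | add _ _ ihf ihg => exact (InCone.add ihf ihg).congr (fun a => by ring)

theorem sum {D : ℕ} {ι : Type*} (s : Finset ι) (f : ι → Finset (Fin n) → ℝ) (h : ∀ i ∈ s, InCone D (f i)) :
    InCone D (fun a => ∑ i ∈ s, f i a) := by
  classical
  induction s using Finset.induction_on with
  | empty => exact (const D le_rfl).congr (fun a => by simp)
  | @insert i s hi ih =>
      have h1 : InCone D (f i) := h i (Finset.mem_insert_self i s)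
      have h2 : InCone D (fun a => ∑ j ∈ s, f j a) := ih (fun j hj => h j (Finset.mem_insert_of_mem hj))
      exact (InCone.add h1 h2).congr (fun a => by rw [Finset.sum_insert hi])

/-- multiplication by a positive literal `X_e` raises the degree by one -/
theorem mulX {D : ℕ} {f : Finset (Fin n) → ℝ} (e : Fin n) (hf : InCone D f) :
    InCone (D + 1) (fun a => X a e * f a) := by
  classical
  induction hf with
  | @atom w S T hw hST =>
      refine (InCone.atom (S := insert e S) (T := T) hw ?_).congr (fun a => ?_)
      · have := Finset.card_insert_le e S
        omega
      · unfold cj X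
        by_cases he : e ∈ a
        · simp [he, Finset.insert_subset_iff]
        · simp [he, Finset.insert_subset_iff]
  | add _ _ ihf ihg => exact (InCone.add ihf ihg).congr (fun a => by ring)

/-- multiplication by a negative literal `1 − X_e` raises the degree by one -/
theorem mulNX {D : ℕ} {f : Finset (Fin n) → ℝ} (e : Fin n) (hf : InCone D f) :
    InCone (D + 1) (fun a => (1 - X a e) * f a) := by
  classical
  induction hf with
  | @atom w S T hw hST =>
      refine (InCone.atom (S := S) (T := insert e T) hw ?_).congr (fun a => ?_)
      · have := Finset.card_insert_le e T
        omega
      · unfold cj X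
        by_cases he : e ∈ a
        · simp [he, Finset.disjoint_insert_left]
        · simp [he, Finset.disjoint_insert_left]
  | add _ _ ihf ihg => exact (InCone.add ihf ihg).congr (fun a => by ring)

/-- CONDITIONING on the coordinate `e`: `f = X_e·f(insert e ·) + (1−X_e)·f(erase · e)`. -/
theorem cond {D : ℕ} {f : Finset (Fin n) → ℝ} (e : Fin n)
    (h1 : InCone D (fun a => f (insert e a))) (h0 : InCone D (fun a => f (a.erase e))) : InCone (D + 1) f := by
  classical
  refine (InCone.add (mulX e h1) (mulNX e h0)).congr (fun a => ?_)
  unfold X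
  by_cases he : e ∈ a
  · simp [he, Finset.insert_eq_of_mem he]
  · simp [he]

/-- the positive literal, the negative literal and products of two literals are in the cone -/
theorem litX (e : Fin n) : InCone 1 (fun a : Finset (Fin n) => X a e) :=
  (mulX e (const 0 zero_le_one)).congr (fun a => by ring)

theorem litNX (e : Fin n) : InCone 1 (fun a : Finset (Fin n) => 1 - X a e) :=
  (mulNX e (const 0 zero_le_one)).congr (fun a => by ring)

theorem XX (e e' : Fin n) : InCone 2 (fun a : Finset (Fin n) => X a e * X a e') := mulX e (litX e')

theorem NXNX (e e' : Fin n) : InCone 2 (fun a : Finset (Fin n) => (1 - X a e) * (1 - X a e')) := mulNX e (litNX e')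

/-- coefficient extraction: an `InCone D` function is an explicit nonnegative combination of slots of degree `≤ D`. -/
theorem coeffs {D : ℕ} {f : Finset (Fin n) → ℝ} (hf : InCone D f) :
    ∃ c : Finset (Fin n) × Finset (Fin n) → ℝ, (∀ p, 0 ≤ c p) ∧ (∀ p, D < p.1.card + p.2.card → c p = 0) ∧
      ∀ a, f a = ∑ p, c p * cj p.1 p.2 a := by
  classical
  induction hf with
  | @atom w S T hw hST =>
      refine ⟨fun p => if p = (S, T) then w else 0, fun p => ?_, fun p hp => ?_, fun a => ?_⟩
      · dsimp only; split_ifs <;> linarith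
      · dsimp only; split_ifs with h
        · subst h; dsimp only at hp; omega
        · rfl
      · simp only [ite_mul, zero_mul, Finset.sum_ite_eq', Finset.mem_univ, if_true]
  | add hf hg ihf ihg =>
      obtain ⟨c₁, h₁, d₁, e₁⟩ := ihf
      obtain ⟨c₂, h₂, d₂, e₂⟩ := ihg
      refine ⟨fun p => c₁ p + c₂ p, fun p => add_nonneg (h₁ p) (h₂ p), fun p hp => by simp [d₁ p hp, d₂ p hp], fun a => ?_⟩
      dsimp only
      rw [e₁ a, e₂ a, ← Finset.sum_add_distrib]
      exact Finset.sum_congr rfl fun p _ => by ring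

end InCone

/-! ## §2 The cube polynomials and the uniform cube theorem -/

/-- relief literal: insiders (`u ∈ P`) are relieved when ABSENT, outsiders when PRESENT -/
def lit (P : Finset (Fin n)) (u : Fin n) (a : Finset (Fin n)) : ℝ := if u ∈ P then 1 - X a u else X a u

theorem lit_inCone (P : Finset (Fin n)) (u : Fin n) : InCone 1 (lit P u) := by
  by_cases hu : u ∈ P
  · exact (InCone.litNX u).congr (fun a => by simp [lit, hu])
  · exact (InCone.litX u).congr (fun a => by simp [lit, hu])

/-- cube polynomial with NO conditioned element present (`e = 0`): `κ + (1 − Σ_V X)² + Σ_V c_u ℓ_u` -/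
def cubeF (P : Finset (Fin n)) (c : Fin n → ℝ) (V : Finset (Fin n)) (κ : ℝ) (a : Finset (Fin n)) : ℝ :=
  κ + (1 - ∑ u ∈ V, X a u) ^ 2 + ∑ u ∈ V, c u * lit P u a

/-- cube polynomial AFTER a present conditioned element (`e = 1`): `κ + (Σ_V X)² + Σ_V c_u ℓ_u` -/
def cubeT (P : Finset (Fin n)) (c : Fin n → ℝ) (V : Finset (Fin n)) (κ : ℝ) (a : Finset (Fin n)) : ℝ :=
  κ + (∑ u ∈ V, X a u) ^ 2 + ∑ u ∈ V, c u * lit P u a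

section Cube
variable (P : Finset (Fin n)) (c : Fin n → ℝ)

/-- FACT 1: once a conditioned element is present, the polynomial is in the degree-2 cone outright. -/
theorem cubeT_inCone {V : Finset (Fin n)} {κ : ℝ} (hκ : 0 ≤ κ) (hc : ∀ u ∈ V, 0 ≤ c u) :
    InCone 2 (cubeT P c V κ) := by
  have h1 : InCone 2 (fun a : Finset (Fin n) => ∑ u ∈ V, ∑ u' ∈ V, X a u * X a u') :=
    InCone.sum V _ fun u _ => InCone.sum V _ fun u' _ => InCone.XX u u'
  have h2 : InCone 2 (fun a : Finset (Fin n) => ∑ u ∈ V, c u * lit P u a) :=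
    InCone.sum V _ fun u hu => (InCone.smul (hc u hu) (lit_inCone P u)).mono (by norm_num)
  refine (InCone.add (InCone.add (InCone.const 2 hκ) h1) h2).congr (fun a => ?_)
  unfold cubeT
  rw [sq, Finset.sum_mul_sum]

variable {P c}

theorem X_insert_self (a : Finset (Fin n)) (v : Fin n) : X (insert v a) v = 1 := by simp [X]
theorem X_erase_self (a : Finset (Fin n)) (v : Fin n) : X (a.erase v) v = 0 := by simp [X]
theorem X_insert_ne (a : Finset (Fin n)) {u v : Fin n} (h : u ≠ v) : X (insert v a) u = X a u := by simp [X, h]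
theorem X_erase_ne (a : Finset (Fin n)) {u v : Fin n} (h : u ≠ v) : X (a.erase v) u = X a u := by simp [X, h]
theorem lit_insert_ne (a : Finset (Fin n)) {u v : Fin n} (h : u ≠ v) : lit P u (insert v a) = lit P u a := by
  simp [lit, X_insert_ne a h]
theorem lit_erase_ne (a : Finset (Fin n)) {u v : Fin n} (h : u ≠ v) : lit P u (a.erase v) = lit P u a := by
  simp [lit, X_erase_ne a h]
theorem lit_insert_self (a : Finset (Fin n)) (v : Fin n) : lit P v (insert v a) = if v ∈ P then 0 else 1 := by
  by_cases hv : v ∈ P <;> simp [lit, hv, X_insert_self]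
theorem lit_erase_self (a : Finset (Fin n)) (v : Fin n) : lit P v (a.erase v) = if v ∈ P then 1 else 0 := by
  by_cases hv : v ∈ P <;> simp [lit, hv, X_erase_self]

/-- conditioning identity, PRESENT branch -/
theorem cubeF_insert {V : Finset (Fin n)} {v : Fin n} (hv : v ∈ V) (κ : ℝ) (a : Finset (Fin n)) :
    cubeF P c V κ (insert v a) = cubeT P c (V.erase v) (κ + if v ∈ P then 0 else c v) a := by
  unfold cubeF cubeT
  rw [← Finset.add_sum_erase V _ hv, ← Finset.add_sum_erase V (fun u => c u * lit P u (insert v a)) hv]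
  rw [X_insert_self, lit_insert_self]
  have e1 : ∑ u ∈ V.erase v, X (insert v a) u = ∑ u ∈ V.erase v, X a u :=
    Finset.sum_congr rfl fun u hu => X_insert_ne a (Finset.ne_of_mem_erase hu)
  have e2 : ∑ u ∈ V.erase v, c u * lit P u (insert v a) = ∑ u ∈ V.erase v, c u * lit P u a :=
    Finset.sum_congr rfl fun u hu => by rw [lit_insert_ne a (Finset.ne_of_mem_erase hu)]
  rw [e1, e2]
  split_ifs <;> ring

/-- conditioning identity, ABSENT branch -/
theorem cubeF_erase {V : Finset (Fin n)} {v : Fin n} (hv : v ∈ V) (κ : ℝ) (a : Finset (Fin n)) :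
    cubeF P c V κ (a.erase v) = cubeF P c (V.erase v) (κ + if v ∈ P then c v else 0) a := by
  unfold cubeF
  rw [← Finset.add_sum_erase V _ hv, ← Finset.add_sum_erase V (fun u => c u * lit P u (a.erase v)) hv]
  rw [X_erase_self, lit_erase_self]
  have e1 : ∑ u ∈ V.erase v, X (a.erase v) u = ∑ u ∈ V.erase v, X a u :=
    Finset.sum_congr rfl fun u hu => X_erase_ne a (Finset.ne_of_mem_erase hu)
  have e2 : ∑ u ∈ V.erase v, c u * lit P u (a.erase v) = ∑ u ∈ V.erase v, c u * lit P u a :=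
    Finset.sum_congr rfl fun u hu => by rw [lit_erase_ne a (Finset.ne_of_mem_erase hu)]
  rw [e1, e2]
  split_ifs <;> ring

/-- pair sums: `Σ_{i} Σ_{i′ ≠ i} f_i f_{i′} = (Σ f)² − Σ f²` -/
theorem sum_sum_erase (I : Finset (Fin n)) (f : Fin n → ℝ) :
    ∑ i ∈ I, ∑ i' ∈ I.erase i, f i * f i' = (∑ i ∈ I, f i) ^ 2 - ∑ i ∈ I, f i * f i := by
  have h : ∀ i ∈ I, ∑ i' ∈ I.erase i, f i * f i' = f i * (∑ i' ∈ I, f i') - f i * f i := by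
    intro i hi
    rw [← Finset.mul_sum, Finset.sum_erase_eq_sub hi, mul_sub]
  rw [Finset.sum_congr rfl h, Finset.sum_sub_distrib, ← Finset.sum_mul, sq]

/-- THE FAR BASE: if every relief in `V` is `≥ 1`, the unconditioned cube polynomial is in the degree-2 cone for every `κ ≥ 0`
(symmetric relief identity; `t = |V ∩ P|`, `s = |a ∩ V ∩ P|`, `u = |a ∩ V ∖ P|`:
`t(1−s−u)² = −(t−2)(t−s) + (t−1)(s²−s) + (t−s)(t−s−1) + t(u² − 2u + 2su)`). -/
theorem cubeF_far {V : Finset (Fin n)} {κ : ℝ} (hκ : 0 ≤ κ) (hc : ∀ u ∈ V, 1 ≤ c u) :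
    InCone 2 (cubeF P c V κ) := by
  classical
  set I := V.filter (fun u => u ∈ P) with hI
  set O := V.filter (fun u => u ∉ P) with hO
  have hIP : ∀ i ∈ I, i ∈ P := fun i hi => (Finset.mem_filter.mp hi).2
  have hOP : ∀ j ∈ O, j ∉ P := fun j hj => (Finset.mem_filter.mp hj).2
  have hIV : ∀ i ∈ I, i ∈ V := fun i hi => (Finset.mem_filter.mp hi).1
  have hOV : ∀ j ∈ O, j ∈ V := fun j hj => (Finset.mem_filter.mp hj).1
  -- the common outsider part: Σ_O (c_j − 1) X_j + 2 Σ_{I×O} X_i X_j + Σ_{j ≠ j′ ∈ O} X_j X_{j′}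
  have hOut : InCone 2 (fun a : Finset (Fin n) => ∑ j ∈ O, (c j - 1) * X a j +
      2 * ∑ i ∈ I, ∑ j ∈ O, X a i * X a j + ∑ j ∈ O, ∑ j' ∈ O.erase j, X a j * X a j') := by
    refine InCone.add (InCone.add ?_ ?_) ?_
    · exact InCone.sum O _ fun j hj => (InCone.smul (by linarith [hc j (hOV j hj)]) (InCone.litX j)).mono (by norm_num)
    · exact InCone.smul (by norm_num) (InCone.sum I _ fun i _ => InCone.sum O _ fun j _ => InCone.XX i j)
    · exact InCone.sum O _ fun j _ => InCone.sum (O.erase j) _ fun j' _ => InCone.XX j j'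
  -- splitting the sums over V
  have splitX : ∀ a : Finset (Fin n), ∑ u ∈ V, X a u = ∑ i ∈ I, X a i + ∑ j ∈ O, X a j := fun a =>
    (Finset.sum_filter_add_sum_filter_not V (fun u => u ∈ P) _).symm
  have splitR : ∀ a : Finset (Fin n), ∑ u ∈ V, c u * lit P u a =
      ∑ i ∈ I, c i * (1 - X a i) + ∑ j ∈ O, c j * X a j := by
    intro a
    rw [← Finset.sum_filter_add_sum_filter_not V (fun u => u ∈ P)]
    congr 1
    · exact Finset.sum_congr rfl fun i hi => by rw [show lit P i a = 1 - X a i by simp [lit, hIP i hi]]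
    · exact Finset.sum_congr rfl fun j hj => by rw [show lit P j a = X a j by simp [lit, hOP j hj]]
  -- pair-sum evaluations
  have pairX : ∀ (A : Finset (Fin n)) (a : Finset (Fin n)),
      ∑ i ∈ A, ∑ i' ∈ A.erase i, X a i * X a i' = (∑ i ∈ A, X a i) ^ 2 - ∑ i ∈ A, X a i := by
    intro A a
    rw [sum_sum_erase]
    congr 1
    exact Finset.sum_congr rfl fun i _ => X_mul_self a i
  have pairNX : ∀ (A : Finset (Fin n)) (a : Finset (Fin n)),
      ∑ i ∈ A, ∑ i' ∈ A.erase i, (1 - X a i) * (1 - X a i') = (∑ i ∈ A, (1 - X a i)) ^ 2 - ∑ i ∈ A, (1 - X a i) := by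
    intro A a
    rw [sum_sum_erase A (fun i => 1 - X a i)]
    congr 1
    refine Finset.sum_congr rfl fun i _ => ?_
    have := X_mul_self a i
    ring_nf; nlinarith [this]
  have sumNX : ∀ (A : Finset (Fin n)) (a : Finset (Fin n)), ∑ i ∈ A, (1 - X a i) = (A.card : ℝ) - ∑ i ∈ A, X a i := by
    intro A a
    rw [Finset.sum_sub_distrib, Finset.sum_const, nsmul_eq_mul, mul_one]
  rcases Nat.eq_zero_or_pos I.card with ht | ht
  · -- no insiders: `κ + 1 + outsider part`
    have hIe : I = ∅ := Finset.card_eq_zero.mp ht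
    refine (InCone.add (InCone.const 2 (show (0:ℝ) ≤ κ + 1 by linarith)) hOut).congr (fun a => ?_)
    unfold cubeF
    rw [splitX a, splitR a, hIe]
    simp only [Finset.sum_empty, zero_add]
    have p2 := pairX O a
    set u := ∑ j ∈ O, X a j with hu
    have eO : ∑ j ∈ O, (c j - 1) * X a j = ∑ j ∈ O, c j * X a j - u := by
      rw [hu, ← Finset.sum_sub_distrib]; exact Finset.sum_congr rfl fun j _ => by ring
    rw [p2, eO]
    ring
  · -- `t ≥ 1` insiders: symmetric relief identity
    have htR : (0:ℝ) < (I.card : ℝ) := by exact_mod_cast ht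
    set t : ℝ := (I.card : ℝ) with htdef
    have hIn : InCone 2 (fun a : Finset (Fin n) => ∑ i ∈ I, (c i - (t - 2) / t) * (1 - X a i) +
        ((t - 1) / t) * ∑ i ∈ I, ∑ i' ∈ I.erase i, X a i * X a i' +
        (1 / t) * ∑ i ∈ I, ∑ i' ∈ I.erase i, (1 - X a i) * (1 - X a i')) := by
      refine InCone.add (InCone.add ?_ ?_) ?_
      · refine InCone.sum I _ fun i hi => (InCone.smul ?_ (InCone.litNX i)).mono (by norm_num)
        have h1 := hc i (hIV i hi)
        have : (t - 2) / t ≤ 1 := by rw [div_le_one htR]; linarith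
        linarith
      · refine InCone.smul ?_ (InCone.sum I _ fun i _ => InCone.sum (I.erase i) _ fun i' _ => InCone.XX i i')
        have : (1:ℝ) ≤ t := by rw [htdef]; exact_mod_cast (ht : 1 ≤ I.card)
        exact div_nonneg (by linarith) htR.le
      · exact InCone.smul (by positivity) (InCone.sum I _ fun i _ => InCone.sum (I.erase i) _ fun i' _ => InCone.NXNX i i')
    refine (InCone.add (InCone.add (InCone.const 2 hκ) hIn) hOut).congr (fun a => ?_)
    unfold cubeF
    rw [splitX a, splitR a, pairX I a, pairNX I a, pairX O a, sumNX I a, ← Finset.sum_mul_sum]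
    set s := ∑ i ∈ I, X a i with hs
    set u := ∑ j ∈ O, X a j with hu
    have eI : ∑ i ∈ I, (c i - (t - 2) / t) * (1 - X a i) = ∑ i ∈ I, c i * (1 - X a i) - ((t - 2) / t) * (t - s) := by
      rw [← sumNX I a, Finset.mul_sum, ← Finset.sum_sub_distrib]
      exact Finset.sum_congr rfl fun i _ => by ring
    have eO : ∑ j ∈ O, (c j - 1) * X a j = ∑ j ∈ O, c j * X a j - u := by
      rw [hu, ← Finset.sum_sub_distrib]; exact Finset.sum_congr rfl fun j _ => by ring
    rw [eI, eO]
    have hst : t ≠ 0 := htR.ne'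
    rw [show ((I.card : ℕ) : ℝ) = t from rfl]
    field_simp
    ring

/-- ★ THE UNIFORM CUBE THEOREM: if the reliefs are nonnegative on `V` and `≥ 1` off a set `N ⊆ V` of "near" elements, then the
unconditioned cube polynomial lies in the cone of conjunctions of at most `|N| + 2` literals (condition on the elements of `N` one at a
time: a PRESENT branch is a Fact-1 leaf, the all-absent leaf is the far base). -/
theorem cubeF_inCone (N : Finset (Fin n)) :
    ∀ (V : Finset (Fin n)) (κ : ℝ), N ⊆ V → 0 ≤ κ → (∀ u ∈ V, 0 ≤ c u) → (∀ u ∈ V, u ∉ N → 1 ≤ c u) →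
      InCone (N.card + 2) (cubeF P c V κ) := by
  classical
  induction N using Finset.induction_on with
  | empty =>
      intro V κ _ hκ _ hc1
      simpa using cubeF_far (P := P) (c := c) hκ (fun u hu => hc1 u hu (Finset.notMem_empty u))
  | @insert v N hvN ih =>
      intro V κ hNV hκ hc0 hc1
      have hv : v ∈ V := hNV (Finset.mem_insert_self v N)
      have hcv : 0 ≤ c v := hc0 v hv
      have h1 : InCone (N.card + 2) (fun a => cubeF P c V κ (insert v a)) := by
        have := cubeT_inCone P c (V := V.erase v) (κ := κ + if v ∈ P then 0 else c v)
          (by split_ifs <;> linarith) (fun u hu => hc0 u (Finset.mem_of_mem_erase hu))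
        exact (this.mono (by omega)).congr (fun a => (cubeF_insert hv κ a).symm)
      have h0 : InCone (N.card + 2) (fun a => cubeF P c V κ (a.erase v)) := by
        have := ih (V.erase v) (κ + if v ∈ P then c v else 0)
          (fun u hu => Finset.mem_erase.mpr ⟨fun h => hvN (h ▸ hu), hNV (Finset.mem_insert_of_mem hu)⟩)
          (by split_ifs <;> linarith) (fun u hu => hc0 u (Finset.mem_of_mem_erase hu))
          (fun u hu huN => hc1 u (Finset.mem_of_mem_erase hu)
            (by rw [Finset.mem_insert]; exact not_or.mpr ⟨Finset.ne_of_mem_erase hu, huN⟩))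
        exact this.congr (fun a => (cubeF_erase hv _ a).symm)
      have h := InCone.cond v h1 h0
      have hcard : (insert v N).card + 2 = N.card + 2 + 1 := by
        rw [Finset.card_insert_of_notMem hvN]
      rw [hcard]
      exact h

end Cube

/-! ## §3 Slice transfer (identities I1 / I2 for a general permutation) and packaging -/

section Slice
variable (π : Equiv.Perm (Fin n))

/-- inversion indicator over `ℝ`: `χ l l′ = [π(l′) < π(l)]` -/
def χ (l l' : Fin n) : ℝ := if π l' < π l then 1 else 0

theorem inv_cast (a : Finset (Fin n)) : (inv a π : ℝ) = ∑ l, ∑ l', X a l * (1 - X a l') * χ π l l' := by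
  simp only [inv, ind, invInd, X, χ]
  push_cast
  rfl

/-- trichotomy: `[π l′ < π l] + [π l < π l′] + [l = l′] = 1` -/
theorem χ_trich (l l' : Fin n) : χ π l l' + χ π l' l + (if l = l' then (1:ℝ) else 0) = 1 := by
  unfold χ
  by_cases h1 : π l' < π l
  · have h2 : ¬ π l < π l' := lt_asymm h1
    have h3 : l ≠ l' := fun h => by subst h; exact lt_irrefl _ h1
    simp [h1, h2, h3]
  · by_cases h2 : π l < π l'
    · have h3 : l ≠ l' := fun h => by subst h; exact lt_irrefl _ h2
      simp [h1, h2, h3]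
    · have h3 : l = l' := π.injective (le_antisymm (not_lt.mp h1) (not_lt.mp h2))
      simp [h3]

theorem sum_X_univ (a : Finset (Fin n)) : ∑ l, X a l = (a.card : ℝ) := by
  rw [sum_X]; simp

/-- `#{l : π l < π l′} = π l′` -/
theorem card_filter_lt (l' : Fin n) :
    (((Finset.univ.filter fun l : Fin n => π l < π l').card : ℕ) : ℝ) = ((π l' : ℕ) : ℝ) := by
  have h : (Finset.univ.filter fun l : Fin n => π l < π l') = posLT π (π l' : ℕ) := by
    ext l
    simp only [posLT, Finset.mem_filter, Finset.mem_univ, true_and]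
    exact Fin.lt_def
  rw [h, card_posLT π (π l').isLt.le]

theorem sum_χ (l : Fin n) : ∑ l', χ π l l' = ((π l : ℕ) : ℝ) := by
  unfold χ
  rw [Finset.sum_boole]
  exact card_filter_lt π l

/-- `Σ_l X_l [π l′ < π l] = k − X_{l′} − Σ_l X_l [π l < π l′]` on the slice `|a| = k` -/
theorem sum_Xχ_flip {k : ℕ} {a : Finset (Fin n)} (hk : a.card = k) (l' : Fin n) :
    ∑ l, X a l * χ π l l' = (k : ℝ) - X a l' - ∑ l, X a l * χ π l' l := by
  classical
  have hka : ∑ l, X a l = (k : ℝ) := by rw [sum_X_univ, hk]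
  have e : ∀ l, X a l * χ π l l' = X a l - X a l * χ π l' l - X a l * (if l = l' then 1 else 0) := by
    intro l
    have h := χ_trich π l l'
    linear_combination (X a l) * h
  rw [Finset.sum_congr rfl (fun l _ => e l), Finset.sum_sub_distrib, Finset.sum_sub_distrib, hka]
  simp only [mul_ite, mul_one, mul_zero, Finset.sum_ite_eq', Finset.mem_univ, if_true]
  ring

/-- `Σ_l X_l [π l < π l′] = Σ_{j : π j < π l′} X_j` -/
theorem sum_Xχ_filter (a : Finset (Fin n)) (l' : Fin n) :
    ∑ l, X a l * χ π l' l = ∑ j ∈ Finset.univ.filter (fun j => π j < π l'), X a j := by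
  rw [Finset.sum_filter]
  exact Finset.sum_congr rfl fun l _ => by unfold χ; split_ifs <;> ring

/-- `Σ_{l′} X_{l′} [π l < π l′] = Σ_{j : π l < π j} X_j` -/
theorem sum_Xχ_filter' (a : Finset (Fin n)) (l : Fin n) :
    ∑ l', X a l' * χ π l' l = ∑ j ∈ Finset.univ.filter (fun j => π l < π j), X a j := by
  rw [Finset.sum_filter]
  exact Finset.sum_congr rfl fun l' _ => by unfold χ; split_ifs <;> ring

/-- IDENTITY I1 on the slice `|a| = k` (insider-side count of the inversions):
`inv(a;π) = Σ_{l′ ∈ P} (k − π l′)(1 − X_{l′}) + Σ_{l′ ∈ P} Σ_{π j < π l′} (1 − X_j)(1 − X_{l′}) + Σ_{l′ ∉ P} Σ_{π l′ < π l} (1 − X_{l′}) X_l`,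
`P = posLT π k`. -/
theorem inv_I1 {k : ℕ} {a : Finset (Fin n)} (hk : a.card = k) :
    (inv a π : ℝ) =
      ∑ l' ∈ posLT π k, ((k : ℝ) - ((π l' : ℕ) : ℝ)) * (1 - X a l') +
      ∑ l' ∈ posLT π k, ∑ j ∈ Finset.univ.filter (fun j => π j < π l'), (1 - X a j) * (1 - X a l') +
      ∑ l' ∈ Finset.univ.filter (fun l' : Fin n => ¬ ((π l' : ℕ) < k)),
        ∑ l ∈ Finset.univ.filter (fun l => π l' < π l), (1 - X a l') * X a l := by
  classical
  have partA : ∀ l' : Fin n, ∑ l, X a l * (1 - X a l') * χ π l l' =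
      ∑ l ∈ Finset.univ.filter (fun l => π l' < π l), (1 - X a l') * X a l := by
    intro l'
    rw [Finset.sum_filter]
    refine Finset.sum_congr rfl fun l _ => ?_
    unfold χ; split_ifs <;> ring
  have partB : ∀ l' : Fin n, ∑ l, X a l * (1 - X a l') * χ π l l' =
      ((k : ℝ) - ((π l' : ℕ) : ℝ)) * (1 - X a l') +
        ∑ j ∈ Finset.univ.filter (fun j => π j < π l'), (1 - X a j) * (1 - X a l') := by
    intro l'
    have e0 : ∑ l, X a l * (1 - X a l') * χ π l l' = (1 - X a l') * ∑ l, X a l * χ π l l' := by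
      rw [Finset.mul_sum]; exact Finset.sum_congr rfl fun l _ => by ring
    have h2 : ∑ j ∈ Finset.univ.filter (fun j => π j < π l'), X a j = ((π l' : ℕ) : ℝ) -
        ∑ j ∈ Finset.univ.filter (fun j => π j < π l'), (1 - X a j) := by
      rw [Finset.sum_sub_distrib, Finset.sum_const, nsmul_eq_mul, mul_one, card_filter_lt]; ring
    rw [e0, sum_Xχ_flip π hk, sum_Xχ_filter, h2]
    have hx := X_mul_self a l'
    have : (1 - X a l') * ((k:ℝ) - X a l' - (((π l' : ℕ) : ℝ) -
        ∑ j ∈ Finset.univ.filter (fun j => π j < π l'), (1 - X a j)))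
        = ((k : ℝ) - ((π l' : ℕ) : ℝ)) * (1 - X a l') +
          (1 - X a l') * ∑ j ∈ Finset.univ.filter (fun j => π j < π l'), (1 - X a j) -
          (X a l' - X a l' * X a l') := by ring
    rw [this, hx, sub_self, sub_zero, Finset.mul_sum]
    congr 1
    exact Finset.sum_congr rfl fun j _ => by ring
  rw [inv_cast, Finset.sum_comm,
    ← Finset.sum_filter_add_sum_filter_not Finset.univ (fun l' : Fin n => ((π l' : ℕ)) < k)]
  congr 1
  · rw [← Finset.sum_add_distrib]
    exact Finset.sum_congr rfl fun l' _ => partB l'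
  · exact Finset.sum_congr rfl fun l' _ => partA l'

/-- IDENTITY I2 on the slice `|a| = k` (outsider-side count of the inversions):
`inv(a;π) = Σ_{l ∉ P} (π l + 1 − k) X_l + Σ_{l ∉ P} Σ_{π l < π j} X_l X_j + Σ_{l ∈ P} Σ_{π j < π l} X_l (1 − X_j)`. -/
theorem inv_I2 {k : ℕ} {a : Finset (Fin n)} (hk : a.card = k) :
    (inv a π : ℝ) =
      ∑ l ∈ Finset.univ.filter (fun l : Fin n => ¬ ((π l : ℕ) < k)), ((((π l : ℕ) : ℝ) + 1 - k) * X a l) +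
      ∑ l ∈ Finset.univ.filter (fun l : Fin n => ¬ ((π l : ℕ) < k)),
        ∑ j ∈ Finset.univ.filter (fun j => π l < π j), X a l * X a j +
      ∑ l ∈ posLT π k, ∑ j ∈ Finset.univ.filter (fun j => π j < π l), X a l * (1 - X a j) := by
  classical
  have e : ∀ l, ∑ l', X a l * (1 - X a l') * χ π l l' = X a l * ∑ l', (1 - X a l') * χ π l l' := by
    intro l; rw [Finset.mul_sum]; exact Finset.sum_congr rfl fun l' _ => by ring
  have partD : ∀ l, X a l * ∑ l', (1 - X a l') * χ π l l' =
      ∑ j ∈ Finset.univ.filter (fun j => π j < π l), X a l * (1 - X a j) := by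
    intro l
    rw [Finset.mul_sum, Finset.sum_filter]
    exact Finset.sum_congr rfl fun l' _ => by unfold χ; split_ifs <;> ring
  have partC : ∀ l, X a l * ∑ l', (1 - X a l') * χ π l l' =
      (((π l : ℕ) : ℝ) + 1 - k) * X a l + ∑ j ∈ Finset.univ.filter (fun j => π l < π j), X a l * X a j := by
    intro l
    have h1 : ∑ l', (1 - X a l') * χ π l l' = ((π l : ℕ) : ℝ) - ∑ l', X a l' * χ π l l' := by
      have : ∀ l', (1 - X a l') * χ π l l' = χ π l l' - X a l' * χ π l l' := fun l' => by ring
      rw [Finset.sum_congr rfl (fun l' _ => this l'), Finset.sum_sub_distrib, sum_χ]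
    have h2 : ∑ l', X a l' * χ π l l' = (k : ℝ) - X a l - ∑ l', X a l' * χ π l' l := by
      have := sum_Xχ_flip π hk l
      linarith
    rw [h1, h2, sum_Xχ_filter']
    have hx := X_mul_self a l
    have : X a l * (((π l : ℕ) : ℝ) - ((k : ℝ) - X a l -
        ∑ j ∈ Finset.univ.filter (fun j => π l < π j), X a j))
        = (((π l : ℕ) : ℝ) + 1 - k) * X a l + X a l * ∑ j ∈ Finset.univ.filter (fun j => π l < π j), X a j
          - (X a l - X a l * X a l) := by ring
    rw [this, hx, sub_self, sub_zero, Finset.mul_sum]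
  rw [inv_cast, Finset.sum_congr rfl (fun l _ => e l),
    ← Finset.sum_filter_add_sum_filter_not Finset.univ (fun l : Fin n => ((π l : ℕ)) < k), add_comm]
  congr 1
  · rw [← Finset.sum_add_distrib]
    exact Finset.sum_congr rfl fun l _ => partC l
  · exact Finset.sum_congr rfl fun l _ => partD l

end Slice

section Column
variable (lam : ℝ) (π : Equiv.Perm (Fin n)) (k : ℕ) (b : Finset (Fin n))

/-- the reliefs `(λ/2)·dist(u)`: `dist = k − π u` for insiders (`π u < k`), `π u + 1 − k` for outsiders -/
def relief (u : Fin n) : ℝ :=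
  if (π u : ℕ) < k then lam / 2 * ((k : ℝ) - ((π u : ℕ) : ℝ)) else lam / 2 * (((π u : ℕ) : ℝ) + 1 - k)

/-- the explicit degree-2 slack of the slice transfer (`θ = ½`): `(λ/2)(R₁ + R₂)` plus the reliefs of the elements NOT in `b` -/
def slack (a : Finset (Fin n)) : ℝ :=
  lam / 2 * (∑ l' ∈ posLT π k, ∑ j ∈ Finset.univ.filter (fun j => π j < π l'), (1 - X a j) * (1 - X a l') +
    ∑ l' ∈ Finset.univ.filter (fun l' : Fin n => ¬ ((π l' : ℕ) < k)),
      ∑ l ∈ Finset.univ.filter (fun l => π l' < π l), (1 - X a l') * X a l) +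
  lam / 2 * (∑ l ∈ Finset.univ.filter (fun l : Fin n => ¬ ((π l : ℕ) < k)),
      ∑ j ∈ Finset.univ.filter (fun j => π l < π j), X a l * X a j +
    ∑ l ∈ posLT π k, ∑ j ∈ Finset.univ.filter (fun j => π j < π l), X a l * (1 - X a j)) +
  lam / 2 * ∑ u ∈ bᶜ.filter (fun u => (π u : ℕ) < k), ((k : ℝ) - ((π u : ℕ) : ℝ)) * (1 - X a u) +
  lam / 2 * ∑ u ∈ bᶜ.filter (fun u => ¬ (π u : ℕ) < k), (((π u : ℕ) : ℝ) + 1 - k) * X a u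

/-- ★ SLICE TRANSFER: on the slice `|a| = k` the located-pencil column equals the cube polynomial of `b` with reliefs `(λ/2)·dist`
plus the explicit slack. -/
theorem col_eq {a : Finset (Fin n)} (hk : a.card = k) :
    ((1 : ℝ) - ((a ∩ b).card : ℝ)) ^ 2 + lam * (inv a π : ℝ) =
      cubeF (posLT π k) (relief lam π k) b 0 a + slack lam π k b a := by
  classical
  have h1 := inv_I1 π hk
  have h2 := inv_I2 π hk
  have hP : ∀ u : Fin n, u ∈ posLT π k ↔ (π u : ℕ) < k := fun u => by simp [posLT]
  have splitP : ∀ f : Fin n → ℝ, ∑ u ∈ Finset.univ.filter (fun u : Fin n => (π u : ℕ) < k), f u =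
      ∑ u ∈ b.filter (fun u => (π u : ℕ) < k), f u + ∑ u ∈ bᶜ.filter (fun u => (π u : ℕ) < k), f u := by
    intro f
    rw [Finset.sum_filter, Finset.sum_filter, Finset.sum_filter, Finset.sum_add_sum_compl]
  have splitN : ∀ f : Fin n → ℝ, ∑ u ∈ Finset.univ.filter (fun u : Fin n => ¬ (π u : ℕ) < k), f u =
      ∑ u ∈ b.filter (fun u => ¬ (π u : ℕ) < k), f u + ∑ u ∈ bᶜ.filter (fun u => ¬ (π u : ℕ) < k), f u := by
    intro f
    rw [Finset.sum_filter, Finset.sum_filter, Finset.sum_filter, Finset.sum_add_sum_compl]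
  have hR : ∑ u ∈ b, relief lam π k u * lit (posLT π k) u a =
      lam / 2 * ∑ u ∈ b.filter (fun u => (π u : ℕ) < k), ((k : ℝ) - ((π u : ℕ) : ℝ)) * (1 - X a u) +
      lam / 2 * ∑ u ∈ b.filter (fun u => ¬ (π u : ℕ) < k), (((π u : ℕ) : ℝ) + 1 - k) * X a u := by
    rw [← Finset.sum_filter_add_sum_filter_not b (fun u : Fin n => (π u : ℕ) < k), Finset.mul_sum, Finset.mul_sum]
    congr 1
    · refine Finset.sum_congr rfl fun u hu => ?_
      have hu' : (π u : ℕ) < k := (Finset.mem_filter.mp hu).2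
      simp [relief, lit, hu', (hP u).mpr hu']; ring
    · refine Finset.sum_congr rfl fun u hu => ?_
      have hu' : ¬ (π u : ℕ) < k := (Finset.mem_filter.mp hu).2
      have huP : u ∉ posLT π k := fun h => hu' ((hP u).mp h)
      simp [relief, lit, hu', huP]
      ring
  have hQ : ((1 : ℝ) - ((a ∩ b).card : ℝ)) ^ 2 = (1 - ∑ u ∈ b, X a u) ^ 2 := by rw [sum_X]
  have hinv : lam * (inv a π : ℝ) =
      lam / 2 * (∑ l' ∈ posLT π k, ((k : ℝ) - ((π l' : ℕ) : ℝ)) * (1 - X a l') +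
        ∑ l' ∈ posLT π k, ∑ j ∈ Finset.univ.filter (fun j => π j < π l'), (1 - X a j) * (1 - X a l') +
        ∑ l' ∈ Finset.univ.filter (fun l' : Fin n => ¬ ((π l' : ℕ) < k)),
          ∑ l ∈ Finset.univ.filter (fun l => π l' < π l), (1 - X a l') * X a l) +
      lam / 2 * (∑ l ∈ Finset.univ.filter (fun l : Fin n => ¬ ((π l : ℕ) < k)), ((((π l : ℕ) : ℝ) + 1 - k) * X a l) +
        ∑ l ∈ Finset.univ.filter (fun l : Fin n => ¬ ((π l : ℕ) < k)),
          ∑ j ∈ Finset.univ.filter (fun j => π l < π j), X a l * X a j +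
        ∑ l ∈ posLT π k, ∑ j ∈ Finset.univ.filter (fun j => π j < π l), X a l * (1 - X a j)) := by
    rw [← h1, ← h2]; ring
  have hA := splitP (fun u => ((k : ℝ) - ((π u : ℕ) : ℝ)) * (1 - X a u))
  have hB := splitN (fun u => (((π u : ℕ) : ℝ) + 1 - k) * X a u)
  rw [hQ, hinv]
  unfold cubeF slack
  rw [hR]
  rw [show posLT π k = Finset.univ.filter (fun u : Fin n => (π u : ℕ) < k) from rfl]
  linear_combination (lam / 2) * hA + (lam / 2) * hB

/-- the NEAR set: elements of `b` whose relief is `< 1` (distance `< 2/λ` from the cut) -/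
def near : Finset (Fin n) := b.filter (fun u => relief lam π k u < 1)

variable {lam}

theorem relief_nonneg (hlam : 0 < lam) (u : Fin n) : 0 ≤ relief lam π k u := by
  unfold relief
  split_ifs with h
  · have : ((π u : ℕ) : ℝ) + 1 ≤ (k : ℝ) := by exact_mod_cast h
    nlinarith
  · push Not at h
    have : (k : ℝ) ≤ ((π u : ℕ) : ℝ) := by exact_mod_cast h
    nlinarith

/-- at most `2T − 2` elements are near when `λT ≥ 2` (their positions lie in an integer interval of that length) -/
theorem near_card (hlam : 0 < lam) {T : ℕ} (hT : 2 ≤ lam * T) : (near lam π k b).card ≤ 2 * T - 2 := by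
  classical
  have key : ∀ u ∈ near lam π k b, (π u : ℕ) ∈ Finset.Ico (k + 1 - T) (k + T - 1) := by
    intro u hu
    have hr : relief lam π k u < 1 := (Finset.mem_filter.mp hu).2
    rw [Finset.mem_Ico]
    unfold relief at hr
    split_ifs at hr with hp
    · have hlt : ((k : ℝ) - ((π u : ℕ) : ℝ)) < T := by
        by_contra hc
        push Not at hc
        have : lam / 2 * (T : ℝ) ≤ lam / 2 * ((k : ℝ) - ((π u : ℕ) : ℝ)) :=
          mul_le_mul_of_nonneg_left hc (by linarith)
        linarith
      have h' : (k : ℝ) < ((π u : ℕ) : ℝ) + T := by linarith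
      have h'' : k < (π u : ℕ) + T := by exact_mod_cast h'
      constructor <;> omega
    · push Not at hp
      have hlt : (((π u : ℕ) : ℝ) + 1 - k) < T := by
        by_contra hc
        push Not at hc
        have : lam / 2 * (T : ℝ) ≤ lam / 2 * (((π u : ℕ) : ℝ) + 1 - k) :=
          mul_le_mul_of_nonneg_left hc (by linarith)
        linarith
      have h' : ((π u : ℕ) : ℝ) + 1 < (k : ℝ) + T := by linarith
      have h'' : (π u : ℕ) + 1 < k + T := by exact_mod_cast h'
      constructor <;> omega
  calc (near lam π k b).card ≤ (Finset.Ico (k + 1 - T) (k + T - 1)).card :=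
        Finset.card_le_card_of_injOn (fun u => (π u : ℕ)) key (fun u _ v _ h => π.injective (Fin.ext h))
    _ = (k + T - 1) - (k + 1 - T) := Nat.card_Ico _ _
    _ ≤ 2 * T - 2 := by omega

theorem slack_inCone (hlam : 0 < lam) : InCone 2 (slack lam π k b) := by
  have hl : 0 ≤ lam / 2 := by linarith
  refine InCone.add (InCone.add (InCone.add (InCone.smul hl (InCone.add ?_ ?_)) (InCone.smul hl (InCone.add ?_ ?_)))
    (InCone.smul hl ?_)) (InCone.smul hl ?_)
  · exact InCone.sum _ _ fun l' _ => InCone.sum _ _ fun j _ => InCone.NXNX j l'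
  · exact InCone.sum _ _ fun l' _ => InCone.sum _ _ fun l _ => InCone.mulNX l' (InCone.litX l)
  · exact InCone.sum _ _ fun l _ => InCone.sum _ _ fun j _ => InCone.XX l j
  · exact InCone.sum _ _ fun l _ => InCone.sum _ _ fun j _ => InCone.mulX l (InCone.litNX j)
  · refine InCone.sum _ _ fun u hu => (InCone.smul ?_ (InCone.litNX u)).mono (by norm_num)
    have h : (π u : ℕ) < k := (Finset.mem_filter.mp hu).2
    have : ((π u : ℕ) : ℝ) + 1 ≤ (k : ℝ) := by exact_mod_cast h
    linarith
  · refine InCone.sum _ _ fun u hu => (InCone.smul ?_ (InCone.litX u)).mono (by norm_num)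
    have h : ¬ (π u : ℕ) < k := (Finset.mem_filter.mp hu).2
    push Not at h
    have : (k : ℝ) ≤ ((π u : ℕ) : ℝ) := by exact_mod_cast h
    linarith

/-- ★ the certified column: cube theorem on the near set + slack, degree `2T` -/
theorem col_inCone (hlam : 0 < lam) {T : ℕ} (hT : 2 ≤ lam * T) :
    InCone (2 * T) (fun a => cubeF (posLT π k) (relief lam π k) b 0 a + slack lam π k b a) := by
  have hT1 : 1 ≤ T := by
    by_contra h
    push Not at h
    have : T = 0 := by omega
    subst this
    simp at hT
    linarith
  have hcube : InCone ((near lam π k b).card + 2) (cubeF (posLT π k) (relief lam π k) b 0) :=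
    cubeF_inCone (P := posLT π k) (c := relief lam π k) (near lam π k b) b 0 (Finset.filter_subset _ _) le_rfl
      (fun u _ => relief_nonneg π k hlam u)
      (fun u hu hN => by
        by_contra h
        push Not at h
        exact hN (Finset.mem_filter.mpr ⟨hu, h⟩))
  have hN := near_card π k b hlam hT
  exact InCone.add (hcube.mono (by omega)) ((slack_inCone π k b hlam).mono (by omega))

/-- the column certificate as an explicit nonnegative coefficient function on slots of degree `≤ 2T` -/
theorem col_cert (hlam : 0 < lam) {T : ℕ} (hT : 2 ≤ lam * T) :
    ∃ cf : Finset (Fin n) × Finset (Fin n) → ℝ, (∀ p, 0 ≤ cf p) ∧ (∀ p, 2 * T < p.1.card + p.2.card → cf p = 0) ∧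
      ∀ a : Finset (Fin n), a.card = k →
        ((1 : ℝ) - ((a ∩ b).card : ℝ)) ^ 2 + lam * (inv a π : ℝ) = ∑ p, cf p * cj p.1 p.2 a := by
  obtain ⟨cf, h0, hd, he⟩ := (col_inCone π k b hlam hT).coeffs
  exact ⟨cf, h0, hd, fun a hk => by rw [col_eq lam π k b hk]; exact he a⟩

end Column

/-- slot type of the factorization: size class × (positive literals, negative literals) -/
abbrev Slot (n : ℕ) := Fin (n + 1) × (Finset (Fin n) × Finset (Fin n))

/-- ★★★ **THEOREM T1 (kernel): the located permutahedron pencil is clique-blind at EVERY real `λ > 0`.**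
For every `n`, every real `λ > 0` and every natural `T` with `λT ≥ 2` there are NONNEGATIVE `U`, `V` over the slot type
`Fin (n+1) × (Finset (Fin n) × Finset (Fin n))` with `(1 − |a∩b|)² + λ·inv(a;π) = Σ_s U a s · V (b,π) s` for ALL rows `a ⊆ [n]` and ALL
columns `(b, π)`, where the row factor `U a (k, S, T′)` vanishes unless `|S| + |T′| ≤ 2T` (and then is the conjunction `[|a| = k][S ⊆ a][T′ ∩ a = ∅]`):
only `(n+1)·Σ_{d ≤ 2T} 2^d·C(n,d) = n^{O(1/λ)}` slots are live.  (`T = ⌈2/λ⌉`; memo `RealLambda39.md` THM T1, uniform strategy.) -/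
theorem real_rankPlus_le (n : ℕ) (lam : ℝ) (hlam : 0 < lam) (T : ℕ) (hT : 2 ≤ lam * T) :
    ∃ (U : Finset (Fin n) → Slot n → ℝ) (V : Finset (Fin n) × Equiv.Perm (Fin n) → Slot n → ℝ),
      (∀ a s, 0 ≤ U a s) ∧ (∀ bπ s, 0 ≤ V bπ s) ∧
      (∀ a s, U a s ≠ 0 → s.2.1.card + s.2.2.card ≤ 2 * T) ∧
      ∀ (a b : Finset (Fin n)) (π : Equiv.Perm (Fin n)),
        ((1 : ℝ) - ((a ∩ b).card : ℝ)) ^ 2 + lam * (inv a π : ℝ) = ∑ s, U a s * V (b, π) s := by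
  classical
  choose cf h0 hd he using
    fun (π : Equiv.Perm (Fin n)) (k : ℕ) (b : Finset (Fin n)) => col_cert (lam := lam) π k b hlam hT
  refine ⟨fun a s => if a.card = (s.1 : ℕ) ∧ s.2.1.card + s.2.2.card ≤ 2 * T then cj s.2.1 s.2.2 a else 0,
    fun bπ s => cf bπ.2 (s.1 : ℕ) bπ.1 s.2, ?_, ?_, ?_, ?_⟩
  · intro a s
    dsimp only
    split_ifs
    · exact cj_nonneg _ _ _
    · exact le_rfl
  · intro bπ s
    exact h0 _ _ _ _
  · intro a s h
    dsimp only at h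
    split_ifs at h with hc
    · exact hc.2
    · exact absurd rfl h
  · intro a b π
    have hkn : a.card < n + 1 := by
      have : a.card ≤ n := by simpa using Finset.card_le_univ a
      omega
    rw [Fintype.sum_prod_type, Finset.sum_eq_single (⟨a.card, hkn⟩ : Fin (n + 1))]
    · rw [he π a.card b a rfl]
      refine Finset.sum_congr rfl fun p _ => ?_
      dsimp only
      by_cases hp : p.1.card + p.2.card ≤ 2 * T
      · simp only [hp, and_true, if_true]
        ring
      · have hz := hd π a.card b p (by omega)
        simp [hp, hz]
    · intro k _ hk
      have hne : a.card ≠ (k : ℕ) := fun e => hk (Fin.ext e.symm)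
      simp [hne]
    · intro h
      exact absurd (Finset.mem_univ _) h


/-! ## §4 The lower half (memo T2): the swap functional — degree `D` FAILS when `λ·m² < m − D`

The signed measure `μ = (1 − m/D)·δ_P + (1/D)·Σ_{j<m} δ_{a_j}` (`a_j = P − x_j + y_j`, insiders `x_j` at positions `k−1−j`, outsiders `y_j` at
positions `k+j`) is nonnegative on every conjunction of `≤ D` literals (a conjunction true at `P` fails at `a_j` only if it mentions `x_j`
positively or `y_j` negatively: at most `|S|+|T| ≤ D` indices `j`), while on the column `b =` the `m` outsider positions nearest the cut
`μ[(1−|a∩b|)² + λ·inv] ≤ (1 − m/D) + λ·m²/D`.  Hence the `k`-slice restriction of that column is NOT in `cone_D` when `λ·m² < m − D`;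
with `m = 2D`: `λ_D ≥ 1/(4D)`.  Together with §3 (`slice_cone_upper`): `1/(4λ) < D(λ) ≤ 2⌈2/λ⌉`. -/

section Lower
variable {m : ℕ} (D : ℕ) (P : Finset (Fin n)) (x y : Fin m → Fin n)

/-- swap row `a_j = P − x_j + y_j` -/
def swapRow (j : Fin m) : Finset (Fin n) := insert (y j) (P.erase (x j))

/-- the swap functional `D·μ[f] = (D − m)·f(P) + Σ_j f(a_j)` -/
def swapFn (f : Finset (Fin n) → ℝ) : ℝ := ((D : ℝ) - m) * f P + ∑ j, f (swapRow P x y j)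

theorem swapFn_add (f g : Finset (Fin n) → ℝ) :
    swapFn D P x y (fun a => f a + g a) = swapFn D P x y f + swapFn D P x y g := by
  unfold swapFn; rw [Finset.sum_add_distrib]; ring

theorem swapFn_smul (w : ℝ) (f : Finset (Fin n) → ℝ) :
    swapFn D P x y (fun a => w * f a) = w * swapFn D P x y f := by
  unfold swapFn; rw [mul_add, Finset.mul_sum]; ring

variable {D P x y}

/-- `μ ≥ 0` on conjunctions of `≤ D` literals (only the injectivity of `x`, `y` is used: a conjunction true at `P` fails at `a_j` only if
`x_j ∈ S` or `y_j ∈ T`) -/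
theorem swapFn_cj_nonneg (hxi : Function.Injective x) (hyi : Function.Injective y)
    (S T : Finset (Fin n)) (hST : S.card + T.card ≤ D) :
    0 ≤ swapFn D P x y (cj S T) := by
  classical
  unfold swapFn
  have hsum0 : 0 ≤ ∑ j, cj S T (swapRow P x y j) := Finset.sum_nonneg fun j _ => cj_nonneg _ _ _
  by_cases hP : S ⊆ P ∧ Disjoint T P
  · have hcP : cj S T P = 1 := by simp [cj, hP]
    rw [hcP, mul_one]
    have hpt : ∀ j, (1 : ℝ) - (if x j ∈ S then 1 else 0) - (if y j ∈ T then 1 else 0) ≤ cj S T (swapRow P x y j) := by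
      intro j
      have h0 := cj_nonneg S T (swapRow P x y j)
      by_cases h1 : x j ∈ S
      · simp only [h1, if_true]
        split_ifs <;> linarith
      · by_cases h2 : y j ∈ T
        · simp only [h1, h2, if_true, if_false]
          linarith
        · have : cj S T (swapRow P x y j) = 1 := by
            unfold cj swapRow
            rw [if_pos]
            constructor
            · intro s hs
              have hsP : s ∈ P := hP.1 hs
              have hsx : s ≠ x j := fun e => h1 (e ▸ hs)
              exact Finset.mem_insert_of_mem (Finset.mem_erase.mpr ⟨hsx, hsP⟩)
            · rw [Finset.disjoint_insert_right]
              exact ⟨h2, hP.2.mono_right (Finset.erase_subset _ _)⟩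
          rw [this]
          simp [h1, h2]
    have hcx : ((Finset.univ.filter fun j => x j ∈ S).card : ℝ) ≤ S.card := by
      exact_mod_cast Finset.card_le_card_of_injOn x (fun j hj => by
        have := (Finset.mem_filter.mp (Finset.mem_coe.mp hj)).2; exact this) (fun j₁ _ j₂ _ e => hxi e)
    have hcy : ((Finset.univ.filter fun j => y j ∈ T).card : ℝ) ≤ T.card := by
      exact_mod_cast Finset.card_le_card_of_injOn y (fun j hj => by
        have := (Finset.mem_filter.mp (Finset.mem_coe.mp hj)).2; exact this) (fun j₁ _ j₂ _ e => hyi e)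
    have hsum : ∑ j : Fin m, ((1 : ℝ) - (if x j ∈ S then 1 else 0) - (if y j ∈ T then 1 else 0))
        = (m : ℝ) - (Finset.univ.filter fun j => x j ∈ S).card - (Finset.univ.filter fun j => y j ∈ T).card := by
      rw [Finset.sum_sub_distrib, Finset.sum_sub_distrib, Finset.sum_const, Finset.card_univ, Fintype.card_fin,
        nsmul_eq_mul, mul_one, Finset.sum_boole, Finset.sum_boole]
    have hle := Finset.sum_le_sum fun j (_ : j ∈ (Finset.univ : Finset (Fin m))) => hpt j
    rw [hsum] at hle
    have hD : ((S.card : ℝ)) + T.card ≤ D := by exact_mod_cast hST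
    linarith
  · have hcP : cj S T P = 0 := by simp [cj, hP]
    rw [hcP, mul_zero, zero_add]
    exact hsum0

/-- `μ ≥ 0` on the whole cone `cone_D` -/
theorem swapFn_nonneg_of_inCone (hxi : Function.Injective x) (hyi : Function.Injective y)
    {g : Finset (Fin n) → ℝ} (hg : InCone D g) : 0 ≤ swapFn D P x y g := by
  induction hg with
  | @atom w S T hw hST =>
    rw [swapFn_smul]
    exact mul_nonneg hw (swapFn_cj_nonneg hxi hyi S T hST)
  | add _ _ ihf ihg =>
    rw [swapFn_add]
    exact add_nonneg ihf ihg

theorem swapRow_card (hx : ∀ j, x j ∈ P) (hy : ∀ j, y j ∉ P) (j : Fin m) : (swapRow P x y j).card = P.card := by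
  unfold swapRow
  rw [Finset.card_insert_of_notMem (fun h => hy j (Finset.mem_of_mem_erase h)), Finset.card_erase_of_mem (hx j)]
  have : 0 < P.card := Finset.card_pos.mpr ⟨x j, hx j⟩
  omega

theorem sum_X_mul (a : Finset (Fin n)) (f : Fin n → ℝ) : ∑ l, X a l * f l = ∑ l ∈ a, f l := by
  classical
  unfold X
  simp only [ite_mul, one_mul, zero_mul]
  rw [Finset.sum_ite_mem, Finset.univ_inter]

theorem swapRow_sum (hx : ∀ j, x j ∈ P) (hy : ∀ j, y j ∉ P) (j : Fin m) (f : Fin n → ℝ) :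
    ∑ l ∈ swapRow P x y j, f l = ∑ l ∈ P, f l - f (x j) + f (y j) := by
  unfold swapRow
  rw [Finset.sum_insert (fun h => hy j (Finset.mem_of_mem_erase h)), ← Finset.add_sum_erase P f (hx j)]
  ring

end Lower

section ClosedForm
variable (π : Equiv.Perm (Fin n))

theorem inv_nonneg_real (a : Finset (Fin n)) : 0 ≤ (inv a π : ℝ) := by
  rw [inv_cast]
  exact Finset.sum_nonneg fun l _ => Finset.sum_nonneg fun l' _ =>
    mul_nonneg (mul_nonneg (X_nonneg _ _) (by linarith [X_le_one a l'])) (by unfold χ; split_ifs <;> norm_num)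

/-- CLOSED FORM: `inv(a;π) = Σ_{l ∈ a} π(l) − (|a|² − |a|)/2` (positions sum minus the internal pairs). -/
theorem inv_closed (a : Finset (Fin n)) :
    (inv a π : ℝ) = ∑ l, X a l * ((π l : ℕ) : ℝ) - ((a.card : ℝ) ^ 2 - a.card) / 2 := by
  classical
  have hS : ∑ l, ∑ l', X a l * X a l' * χ π l l' = ∑ l, ∑ l', X a l * X a l' * χ π l' l := by
    rw [Finset.sum_comm]
    exact Finset.sum_congr rfl fun l _ => Finset.sum_congr rfl fun l' _ => by ring
  have h2S : 2 * ∑ l, ∑ l', X a l * X a l' * χ π l l' = (a.card : ℝ) ^ 2 - a.card := by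
    have e : 2 * ∑ l, ∑ l', X a l * X a l' * χ π l l' =
        ∑ l, ∑ l', (X a l * X a l' - X a l * X a l' * (if l = l' then (1:ℝ) else 0)) := by
      rw [two_mul]
      nth_rewrite 2 [hS]
      rw [← Finset.sum_add_distrib]
      refine Finset.sum_congr rfl fun l _ => ?_
      rw [← Finset.sum_add_distrib]
      refine Finset.sum_congr rfl fun l' _ => ?_
      have h := χ_trich π l l'
      linear_combination (X a l * X a l') * h
    rw [e]
    have e2 : ∀ l, ∑ l', (X a l * X a l' - X a l * X a l' * (if l = l' then (1:ℝ) else 0)) =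
        X a l * ∑ l', X a l' - X a l := by
      intro l
      rw [Finset.sum_sub_distrib, Finset.mul_sum]
      congr 1
      simp only [mul_ite, mul_one, mul_zero, Finset.sum_ite_eq, Finset.mem_univ, if_true]
      exact X_mul_self a l
    rw [Finset.sum_congr rfl fun l _ => e2 l, Finset.sum_sub_distrib, ← Finset.sum_mul, sum_X_univ]
    ring
  have e3 : ∀ l, ∑ l', X a l * (1 - X a l') * χ π l l' =
      X a l * ((π l : ℕ) : ℝ) - ∑ l', X a l * X a l' * χ π l l' := by
    intro l
    rw [← sum_χ π l, Finset.mul_sum, ← Finset.sum_sub_distrib]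
    exact Finset.sum_congr rfl fun l' _ => by ring
  rw [inv_cast, Finset.sum_congr rfl fun l _ => e3 l, Finset.sum_sub_distrib]
  linarith [h2S]

theorem gauss_real (k : ℕ) : ∑ i ∈ Finset.range k, (i : ℝ) = ((k : ℝ) ^ 2 - k) / 2 := by
  induction k with
  | zero => simp
  | succ k ih => rw [Finset.sum_range_succ, ih]; push_cast; ring

theorem odd_sum_range (m : ℕ) : ∑ i ∈ Finset.range m, (2 * (i : ℝ) + 1) = (m : ℝ) ^ 2 := by
  induction m with
  | zero => simp
  | succ m ih => rw [Finset.sum_range_succ, ih]; push_cast; ring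

theorem odd_sum_fin (m : ℕ) : ∑ j : Fin m, (2 * ((j : ℕ) : ℝ) + 1) = (m : ℝ) ^ 2 := by
  have h := Fin.sum_univ_eq_sum_range (fun i : ℕ => 2 * (i : ℝ) + 1) m
  rw [h, odd_sum_range]

/-- `Σ_{l ∈ P} π(l) = (k² − k)/2` for `P = posLT π k` (the positions `0, …, k−1`) -/
theorem sum_pos_posLT {k : ℕ} (hk : k ≤ n) : ∑ l ∈ posLT π k, ((π l : ℕ) : ℝ) = ((k : ℝ) ^ 2 - k) / 2 := by
  classical
  rw [show posLT π k = Finset.univ.filter (fun l : Fin n => (π l : ℕ) < k) from rfl, Finset.sum_filter]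
  have h1 := Equiv.sum_comp π (fun i : Fin n => if (i : ℕ) < k then ((i : ℕ) : ℝ) else 0)
  rw [h1]
  have h2 := Fin.sum_univ_eq_sum_range (fun i : ℕ => if i < k then (i : ℝ) else 0) n
  rw [h2, ← Finset.sum_filter]
  have h3 : (Finset.range n).filter (fun i => i < k) = Finset.range k := by
    ext i; simp only [Finset.mem_filter, Finset.mem_range]; omega
  rw [h3, gauss_real]

end ClosedForm

section T2
variable (π : Equiv.Perm (Fin n)) (k m : ℕ)

/-- the column of T2: the `m` outsider positions nearest the cut, `b = π⁻¹{k, …, k+m−1}` -/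
def cutCol : Finset (Fin n) := Finset.univ.filter (fun u => k ≤ (π u : ℕ) ∧ (π u : ℕ) < k + m)

/-- ★★ **THEOREM T2 (kernel): the degree-`D` certificate FAILS below `(m − D)/m²`.**  If the `k`-slice restriction of the column
`(1 − |a ∩ b|)² + λ·inv(a;π)`, `b = cutCol π k m` (`m ≤ k`, `k + m ≤ n`), agrees with some member of `cone_D`, then `m − D ≤ λ·m²`. -/
theorem slice_cone_lower (D : ℕ) (lam : ℝ) (hlam : 0 ≤ lam) (hmk : m ≤ k) (hkm : k + m ≤ n)
    (h : ∃ g, InCone D g ∧ ∀ a : Finset (Fin n), a.card = k →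
      ((1 : ℝ) - ((a ∩ cutCol π k m).card : ℝ)) ^ 2 + lam * (inv a π : ℝ) = g a) :
    ((m : ℝ) - D) ≤ lam * (m : ℝ) ^ 2 := by
  classical
  by_cases hDm : m ≤ D
  · have h1 : (m : ℝ) ≤ D := by exact_mod_cast hDm
    have h2 : 0 ≤ lam * (m : ℝ) ^ 2 := by positivity
    linarith
  push Not at hDm
  obtain ⟨g, hg, hga⟩ := h
  have hPk : (posLT π k).card = k := card_posLT π (by omega)
  have hmemP : ∀ u, u ∈ posLT π k ↔ (π u : ℕ) < k := fun u => by simp [posLT]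
  have hmemC : ∀ u, u ∈ cutCol π k m ↔ k ≤ (π u : ℕ) ∧ (π u : ℕ) < k + m := fun u => by simp [cutCol]
  let x : Fin m → Fin n := fun j => π.symm ⟨k - 1 - (j : ℕ), by omega⟩
  let y : Fin m → Fin n := fun j => π.symm ⟨k + (j : ℕ), by omega⟩
  have hpx : ∀ j, ((π (x j) : ℕ)) = k - 1 - (j : ℕ) := fun j => by simp [x]
  have hpy : ∀ j, ((π (y j) : ℕ)) = k + (j : ℕ) := fun j => by simp [y]
  have hx : ∀ j, x j ∈ posLT π k := fun j => (hmemP _).mpr (by rw [hpx]; omega)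
  have hy : ∀ j, y j ∉ posLT π k := fun j h => by have := (hmemP _).mp h; rw [hpy] at this; omega
  have hxi : Function.Injective x := by
    intro j₁ j₂ e
    have h' := congrArg (fun u => (π u : ℕ)) e
    simp only [hpx] at h'
    exact Fin.ext (by omega)
  have hyi : Function.Injective y := by
    intro j₁ j₂ e
    have h' := congrArg (fun u => (π u : ℕ)) e
    simp only [hpy] at h'
    exact Fin.ext (by omega)
  have hμ := swapFn_nonneg_of_inCone (D := D) (P := posLT π k) hxi hyi hg
  -- evaluation at P
  have hPc : posLT π k ∩ cutCol π k m = ∅ := by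
    ext u
    simp only [Finset.mem_inter]
    constructor
    · rintro ⟨hu1, hu2⟩
      have := (hmemP u).mp hu1
      have := ((hmemC u).mp hu2).1
      omega
    · intro hu; simp at hu
  have hgP : g (posLT π k) = 1 + lam * (inv (posLT π k) π : ℝ) := by
    rw [← hga _ hPk, hPc]; simp
  -- evaluation at the swap rows
  have hcardj : ∀ j, (swapRow (posLT π k) x y j).card = k := fun j => by rw [swapRow_card hx hy, hPk]
  have hjc : ∀ j, swapRow (posLT π k) x y j ∩ cutCol π k m = {y j} := by
    intro j; ext u
    simp only [swapRow, Finset.mem_inter, Finset.mem_insert, Finset.mem_erase, Finset.mem_singleton, hmemC]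
    constructor
    · rintro ⟨h1 | ⟨_, huP⟩, h2, _⟩
      · exact h1
      · have := (hmemP u).mp huP; omega
    · intro e; subst e; exact ⟨Or.inl rfl, by rw [hpy]; omega, by rw [hpy]; omega⟩
  have hpxR : ∀ j, ((π (x j) : ℕ) : ℝ) = (k : ℝ) - 1 - ((j : ℕ) : ℝ) := by
    intro j
    rw [hpx, show k - 1 - (j : ℕ) = k - ((j : ℕ) + 1) by omega, Nat.cast_sub (by omega)]
    push_cast; ring
  have hpyR : ∀ j, ((π (y j) : ℕ) : ℝ) = (k : ℝ) + ((j : ℕ) : ℝ) := by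
    intro j; rw [hpy]; push_cast; ring
  have hinvj : ∀ j, (inv (swapRow (posLT π k) x y j) π : ℝ) = 2 * ((j : ℕ) : ℝ) + 1 := by
    intro j
    rw [inv_closed, sum_X_mul, swapRow_sum hx hy, hcardj, sum_pos_posLT π (by omega), hpxR, hpyR]
    ring
  have hgj : ∀ j, g (swapRow (posLT π k) x y j) = lam * (2 * ((j : ℕ) : ℝ) + 1) := by
    intro j
    rw [← hga _ (hcardj j), hjc, hinvj]
    simp
  -- the functional inequality
  unfold swapFn at hμ
  rw [hgP, Finset.sum_congr rfl fun j _ => hgj j, ← Finset.mul_sum, odd_sum_fin] at hμ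
  have hneg : ((D : ℝ) - m) ≤ 0 := by
    have : (D : ℝ) < m := by exact_mod_cast hDm
    linarith
  have hi : 0 ≤ lam * (inv (posLT π k) π : ℝ) := mul_nonneg hlam (inv_nonneg_real π _)
  have : ((D : ℝ) - m) * (1 + lam * (inv (posLT π k) π : ℝ)) ≤ (D : ℝ) - m := by nlinarith
  linarith

/-- COROLLARY `λ_D ≥ 1/(4D)` (take `m = 2D`; needs `2D ≤ k`, `k + 2D ≤ n`). -/
theorem slice_cone_lower_quarter (D : ℕ) (lam : ℝ) (hlam : 0 ≤ lam) (hD : 1 ≤ D) (h2D : 2 * D ≤ k)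
    (hn : k + 2 * D ≤ n)
    (h : ∃ g, InCone D g ∧ ∀ a : Finset (Fin n), a.card = k →
      ((1 : ℝ) - ((a ∩ cutCol π k (2 * D)).card : ℝ)) ^ 2 + lam * (inv a π : ℝ) = g a) :
    1 / (4 * (D : ℝ)) ≤ lam := by
  have h1 := slice_cone_lower π k (2 * D) D lam hlam h2D hn h
  push_cast at h1
  have hD' : (0 : ℝ) < D := by exact_mod_cast hD
  rw [div_le_iff₀ (by positivity)]
  by_contra hc
  push Not at hc
  nlinarith

/-- the UPPER half in the same shape (§3): degree `2T` SUCCEEDS for every column as soon as `λT ≥ 2`. -/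
theorem slice_cone_upper (lam : ℝ) (hlam : 0 < lam) (T : ℕ) (hT : 2 ≤ lam * T) (b : Finset (Fin n)) :
    ∃ g, InCone (2 * T) g ∧ ∀ a : Finset (Fin n), a.card = k →
      ((1 : ℝ) - ((a ∩ b).card : ℝ)) ^ 2 + lam * (inv a π : ℝ) = g a :=
  ⟨_, col_inCone π k b hlam hT, fun _ hk => col_eq lam π k b hk⟩

end T2

/-! ## §5  The bound in the tree's currency: `HasNonnegFactorization M_λ ((n+1)^(4T+1))`

`real_rankPlus_le` packaged as `Literature.Combinatorics.Optimization.HasNonnegFactorization` (the notion the calibration theorems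
`…Theorems.NNDivisionHard.Calibration.nonnegRank_C3` and the extended-formulation lemmas consume) with an EXPLICIT POLYNOMIAL size:
the live slots `(size class, conjunction of ≤ 2T literals)` inject into `Fin (n+1) × {S // |S| ≤ 2T}²`, and `#{S ⊆ [n] : |S| ≤ D} ≤ (n+1)^D`.
So `rank₊ M_λ^{(n)} ≤ (n+1)^{4⌈2/λ⌉+1}` for every real `λ > 0` — polynomial for each fixed `λ`, quasi-polynomial down to `λ ≍ 1/polylog n`. -/

section Currency

open Literature.Combinatorics.Optimization (HasNonnegFactorization hasNonnegFactorization_of_fintype)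

/-- The located permutahedron pencil as a real matrix: rows `a ⊆ [n]`, columns `(b, π)`:
`M_λ[a; (b,π)] = (1 − |a ∩ b|)² + λ·inv(a;π)`. -/
def pencil (n : ℕ) (lam : ℝ) (a : Finset (Fin n)) (bπ : Finset (Fin n) × Equiv.Perm (Fin n)) : ℝ :=
  ((1 : ℝ) - ((a ∩ bπ.1).card : ℝ)) ^ 2 + lam * (inv a bπ.2 : ℝ)

/-- Live slots: a size class together with a conjunction of at most `2T` literals. -/
abbrev LiveSlot (n T : ℕ) := {s : Slot n // s.2.1.card + s.2.2.card ≤ 2 * T}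

/-- T1 in the tree's currency, slot form: `M_λ` has a nonnegative factorization through the live slots. -/
theorem hasNonnegFactorization_pencil (n : ℕ) (lam : ℝ) (hlam : 0 < lam) (T : ℕ) (hT : 2 ≤ lam * T) :
    HasNonnegFactorization (pencil n lam) (Fintype.card (LiveSlot n T)) := by
  classical
  obtain ⟨U, V, hU, hV, hdeg, hM⟩ := real_rankPlus_le n lam hlam T hT
  refine hasNonnegFactorization_of_fintype (fun a (s : LiveSlot n T) => U a s.1) (fun s bπ => V bπ s.1)
    (fun _ _ => hU _ _) (fun _ _ => hV _ _) ?_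
  rintro a ⟨b, π⟩
  show pencil n lam a (b, π) = ∑ s : LiveSlot n T, U a s.1 * V (b, π) s.1
  unfold pencil
  rw [hM a b π, ← Finset.sum_filter_of_ne (p := fun s : Slot n => s.2.1.card + s.2.2.card ≤ 2 * T)
    (fun s _ hs => hdeg a s (left_ne_zero_of_mul hs))]
  exact Finset.sum_subtype _ (fun s => by simp) _

/-- `Σ_{d ≤ D} n^d ≤ (n+1)^D`. -/
theorem sum_pow_le (n D : ℕ) : ∑ d ∈ Finset.range (D + 1), n ^ d ≤ (n + 1) ^ D := by
  induction D with
  | zero => simp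
  | succ D ih =>
    rw [Finset.sum_range_succ]
    have h1 : n ^ D ≤ (n + 1) ^ D := Nat.pow_le_pow_left (Nat.le_succ n) D
    calc _ ≤ (n + 1) ^ D + n * (n + 1) ^ D := by
          rw [pow_succ']; exact add_le_add ih (Nat.mul_le_mul_left _ h1)
      _ = (n + 1) ^ (D + 1) := by ring

/-- `#{S ⊆ [n] : |S| ≤ D} ≤ (n+1)^D`. -/
theorem card_subsets_le (n D : ℕ) : Fintype.card {S : Finset (Fin n) // S.card ≤ D} ≤ (n + 1) ^ D := by
  classical
  rw [Fintype.card_subtype]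
  calc (Finset.univ.filter (fun S : Finset (Fin n) => S.card ≤ D)).card
      ≤ ((Finset.range (D + 1)).biUnion (fun d => (Finset.univ : Finset (Fin n)).powersetCard d)).card := by
        apply Finset.card_le_card
        intro S hS
        rw [Finset.mem_filter] at hS
        rw [Finset.mem_biUnion]
        exact ⟨S.card, Finset.mem_range.mpr (Nat.lt_succ_of_le hS.2),
          Finset.mem_powersetCard.mpr ⟨Finset.subset_univ _, rfl⟩⟩
    _ ≤ ∑ d ∈ Finset.range (D + 1), ((Finset.univ : Finset (Fin n)).powersetCard d).card := Finset.card_biUnion_le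
    _ = ∑ d ∈ Finset.range (D + 1), n.choose d := by simp [Finset.card_powersetCard]
    _ ≤ ∑ d ∈ Finset.range (D + 1), n ^ d := Finset.sum_le_sum fun d _ => Nat.choose_le_pow n d
    _ ≤ (n + 1) ^ D := sum_pow_le n D

/-- The live slots are polynomially many: `#LiveSlot n T ≤ (n+1)^(4T+1)`. -/
theorem card_liveSlot_le (n T : ℕ) : Fintype.card (LiveSlot n T) ≤ (n + 1) ^ (4 * T + 1) := by
  classical
  let f : LiveSlot n T →
      Fin (n + 1) × ({S : Finset (Fin n) // S.card ≤ 2 * T} × {S : Finset (Fin n) // S.card ≤ 2 * T}) :=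
    fun s => (s.1.1, ⟨s.1.2.1, by have := s.2; omega⟩, ⟨s.1.2.2, by have := s.2; omega⟩)
  have hf : Function.Injective f := by
    rintro ⟨⟨i, S, R⟩, h⟩ ⟨⟨i', S', R'⟩, h'⟩ hff
    simp only [f, Prod.mk.injEq, Subtype.mk.injEq] at hff
    obtain ⟨rfl, rfl, rfl⟩ := hff
    rfl
  calc Fintype.card (LiveSlot n T)
      ≤ Fintype.card (Fin (n + 1) × ({S : Finset (Fin n) // S.card ≤ 2 * T} × {S : Finset (Fin n) // S.card ≤ 2 * T})) :=
        Fintype.card_le_of_injective f hf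
    _ = (n + 1) * (Fintype.card {S : Finset (Fin n) // S.card ≤ 2 * T} *
          Fintype.card {S : Finset (Fin n) // S.card ≤ 2 * T}) := by
        rw [Fintype.card_prod, Fintype.card_prod, Fintype.card_fin]
    _ ≤ (n + 1) * ((n + 1) ^ (2 * T) * (n + 1) ^ (2 * T)) := by
        gcongr <;> exact card_subsets_le n (2 * T)
    _ = (n + 1) ^ (4 * T + 1) := by ring

/-- ★★★ **T1 in the tree's currency, polynomial form: `rank₊ M_λ^{(n)} ≤ (n+1)^(4T+1)` whenever `λ·T ≥ 2`** (take `T = ⌈2/λ⌉`):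
for every FIXED real `λ > 0` the located permutahedron pencil has nonnegative rank polynomial in `n`; there is no positive
visibility threshold `λ_c`.  (S2 of `SmallLambda39.md` §6; memo `RealLambda39.md`.)  VP ≠ VNP is NOT proved by this. -/
theorem hasNonnegFactorization_pencil_poly (n : ℕ) (lam : ℝ) (hlam : 0 < lam) (T : ℕ) (hT : 2 ≤ lam * T) :
    HasNonnegFactorization (pencil n lam) ((n + 1) ^ (4 * T + 1)) :=
  (hasNonnegFactorization_pencil n lam hlam T hT).mono (card_liveSlot_le n T)

end Currency

/-! ## §6  VISIBLE at small `λ(n)` (memo T3): `rank₊ M_λ ≥ 2^{Ω(min(n, λ^{-1/2}))}` via Braun–Fiorini–Pokutta–Steurer 2012, Theorem 5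

Average the two columns `(b̂, id)` and `(b̂, rev_{2m})` of `M_λ` on the PAIRED rows `â = {2i : i ∈ a} ∪ {2i+1 : i ∉ a}` (`a ⊆ [m]`, `2m ≤ n`;
`b̂ = {2i : i ∈ b}`): `|â ∩ b̂| = |a ∩ b|` and `inv(â; id) + inv(â; rev) = m²` for EVERY `a ⊆ [m]` (closed form `inv_closed`: each `l ∈ â` has
`l + rev l = 2m − 1`), so the average is the `ρ`-extension `(1 − |a ∩ b|)² + λm²/2` of `UDISJ_m`, `ρ = 1 + λm²/2`; a nonnegative factorisation
of `M_λ` through `S` averages to one of it through the same `S`, and the tree's DISCHARGED BFPS Theorem 5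
(`Literature.Combinatorics.Optimization.udisjShift_nonnegRank_explicit`: `e^{ℓ/(144ρ²)} ≤ 32 ℓ ρ |S|` for `4(ℓ−1)+3 ≤ m`) applies.  With
`λm² ≤ 2` (`ρ ≤ 2`): `|S| ≥ e^{ℓ/576}/(64 ℓ)`, `ℓ ≈ m/4`, `m ≈ min(n/2, √(2/λ))` — so `rank₊ M_λ^{(n)} ≥ 2^{Ω(min(n, λ^{−1/2}))}`: the clique rows
SEE `Q^Π_λ` (superpolynomial nonnegative rank, by ANY certificate) as soon as `λ·log² n → 0`, while T1 makes them blind at every constant `λ`.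
The visibility transition `λ*(n)` of S2 therefore EXISTS as a function tending to `0` and sits in `[c/log² n, O(1)]`. -/

section Visible

variable {m : ℕ}

/-- paired row embedding `â = {2i + [i ∉ a] : i < m} ⊆ [n]` (`2m ≤ n`) -/
def rowEmb (hmn : 2 * m ≤ n) (a : Finset (Fin m)) : Finset (Fin n) :=
  Finset.univ.image fun i : Fin m =>
    (⟨2 * (i : ℕ) + (if i ∈ a then 0 else 1), by have := i.2; split_ifs <;> omega⟩ : Fin n)

/-- column embedding `b̂ = {2i : i ∈ b} ⊆ [n]` -/
def colEmb (hmn : 2 * m ≤ n) (b : Finset (Fin m)) : Finset (Fin n) :=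
  b.image fun i : Fin m => (⟨2 * (i : ℕ), by have := i.2; omega⟩ : Fin n)

/-- block reversal `l ↦ 2m − 1 − l` on `l < 2m`, identity above -/
def revFun (hmn : 2 * m ≤ n) (l : Fin n) : Fin n :=
  if h : (l : ℕ) < 2 * m then ⟨2 * m - 1 - (l : ℕ), by omega⟩ else l

theorem revFun_val (hmn : 2 * m ≤ n) (l : Fin n) :
    ((revFun hmn l : Fin n) : ℕ) = if (l : ℕ) < 2 * m then 2 * m - 1 - (l : ℕ) else (l : ℕ) := by
  unfold revFun
  split_ifs <;> rfl

theorem revFun_involutive (hmn : 2 * m ≤ n) : Function.Involutive (revFun (n := n) hmn) := by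
  intro l
  apply Fin.ext
  rw [revFun_val, revFun_val]
  split_ifs <;> omega

/-- the block reversal as a permutation of `Fin n` -/
def revPerm (hmn : 2 * m ≤ n) : Equiv.Perm (Fin n) :=
  Function.Involutive.toPerm (revFun hmn) (revFun_involutive hmn)

theorem revPerm_val (hmn : 2 * m ≤ n) (l : Fin n) :
    ((revPerm hmn l : Fin n) : ℕ) = if (l : ℕ) < 2 * m then 2 * m - 1 - (l : ℕ) else (l : ℕ) := by
  unfold revPerm
  rw [Function.Involutive.coe_toPerm]
  exact revFun_val hmn l

theorem mem_rowEmb (hmn : 2 * m ≤ n) (a : Finset (Fin m)) (l : Fin n) :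
    l ∈ rowEmb hmn a ↔ ∃ i : Fin m, (l : ℕ) = 2 * (i : ℕ) + (if i ∈ a then 0 else 1) := by
  unfold rowEmb
  rw [Finset.mem_image]
  constructor
  · rintro ⟨i, _, rfl⟩
    exact ⟨i, rfl⟩
  · rintro ⟨i, hi⟩
    exact ⟨i, Finset.mem_univ _, Fin.ext hi.symm⟩

theorem lt_of_mem_rowEmb (hmn : 2 * m ≤ n) (a : Finset (Fin m)) (l : Fin n) (hl : l ∈ rowEmb hmn a) :
    (l : ℕ) < 2 * m := by
  obtain ⟨i, hi⟩ := (mem_rowEmb hmn a l).1 hl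
  have := i.2
  split_ifs at hi <;> omega

theorem rowEmb_card (hmn : 2 * m ≤ n) (a : Finset (Fin m)) : (rowEmb hmn a).card = m := by
  unfold rowEmb
  rw [Finset.card_image_of_injective, Finset.card_univ, Fintype.card_fin]
  intro i j hij
  have h := congrArg (fun x : Fin n => (x : ℕ)) hij
  dsimp only at h
  apply Fin.ext
  split_ifs at h <;> omega

theorem rowEmb_inter_colEmb (hmn : 2 * m ≤ n) (a b : Finset (Fin m)) :
    rowEmb hmn a ∩ colEmb hmn b = (a ∩ b).image fun i : Fin m => (⟨2 * (i : ℕ), by have := i.2; omega⟩ : Fin n) := by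
  ext l
  rw [Finset.mem_inter, mem_rowEmb, Finset.mem_image]
  unfold colEmb
  rw [Finset.mem_image]
  constructor
  · rintro ⟨⟨i, hi⟩, ⟨j, hj, rfl⟩⟩
    dsimp only at hi
    by_cases hia : i ∈ a
    · rw [if_pos hia] at hi
      have hij : j = i := Fin.ext (by omega)
      subst hij
      exact ⟨j, Finset.mem_inter.2 ⟨hia, hj⟩, rfl⟩
    · rw [if_neg hia] at hi
      omega
  · rintro ⟨i, hi, rfl⟩
    rw [Finset.mem_inter] at hi
    refine ⟨⟨i, ?_⟩, ⟨i, hi.2, rfl⟩⟩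
    dsimp only
    rw [if_pos hi.1, Nat.add_zero]

theorem rowEmb_inter_colEmb_card (hmn : 2 * m ≤ n) (a b : Finset (Fin m)) :
    (rowEmb hmn a ∩ colEmb hmn b).card = (a ∩ b).card := by
  rw [rowEmb_inter_colEmb, Finset.card_image_of_injective]
  intro i j hij
  have h := congrArg (fun x : Fin n => (x : ℕ)) hij
  dsimp only at h
  exact Fin.ext (by omega)

/-- `inv(â; id) + inv(â; rev) = m²` for every paired row. -/
theorem inv_pair_sum (hmn : 2 * m ≤ n) (a : Finset (Fin m)) :
    (inv (rowEmb hmn a) (1 : Equiv.Perm (Fin n)) : ℝ) + (inv (rowEmb hmn a) (revPerm hmn) : ℝ) = (m : ℝ) ^ 2 := by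
  rw [inv_closed, inv_closed, rowEmb_card]
  have h : ∑ l, X (rowEmb hmn a) l * ((((1 : Equiv.Perm (Fin n)) l : Fin n) : ℕ) : ℝ)
      + ∑ l, X (rowEmb hmn a) l * (((revPerm hmn l : Fin n) : ℕ) : ℝ) = (2 * (m : ℝ) - 1) * m := by
    rw [← Finset.sum_add_distrib]
    have : ∀ l, X (rowEmb hmn a) l * ((((1 : Equiv.Perm (Fin n)) l : Fin n) : ℕ) : ℝ)
        + X (rowEmb hmn a) l * (((revPerm hmn l : Fin n) : ℕ) : ℝ) = X (rowEmb hmn a) l * (2 * (m : ℝ) - 1) := by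
      intro l
      by_cases hl : l ∈ rowEmb hmn a
      · have hlt := lt_of_mem_rowEmb hmn a l hl
        have hr : ((revPerm hmn l : Fin n) : ℕ) = 2 * m - 1 - (l : ℕ) := by rw [revPerm_val, if_pos hlt]
        rw [Equiv.Perm.coe_one, id, hr, ← mul_add]
        congr 1
        have h1 : (l : ℕ) + (2 * m - 1 - (l : ℕ)) = 2 * m - 1 := by omega
        have h2 : (((l : ℕ) : ℝ) + ((2 * m - 1 - (l : ℕ) : ℕ) : ℝ)) = ((2 * m - 1 : ℕ) : ℝ) := by exact_mod_cast h1
        rw [h2]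
        have h3 : 1 ≤ 2 * m := by omega
        push_cast [h3]
        ring
      · simp [X, hl]
    rw [Finset.sum_congr rfl fun l _ => this l, ← Finset.sum_mul, sum_X_univ, rowEmb_card]
    ring
  linear_combination h

open Literature.Combinatorics.Optimization (HasNonnegFactorization udisjShift_nonnegRank_explicit)

/-- ★★★ **THEOREM T3 (kernel): the located permutahedron pencil is clique-VISIBLE at small `λ(n)`.**  If `2m ≤ n`, `4k + 3 ≤ m`,
`0 ≤ λ` and `λ·m² ≤ 2`, then every nonnegative factorisation of `M_λ^{(n)} = pencil n λ` through a finite slot type `S` has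
`e^{(k+1)/576} ≤ 64 (k+1) |S|`.  (Take `m = min(⌊n/2⌋, ⌊√(2/λ)⌋)`, `k = ⌊(m−3)/4⌋`: `rank₊ M_λ ≥ 2^{Ω(min(n, λ^{−1/2}))}`; superpolynomial in
`n` as soon as `λ·log² n → 0`.)  Proof: two-column average on paired rows = `ρ`-extension of `UDISJ_m` with `ρ = 1 + λm²/2 ≤ 2`, then the
tree's discharged BFPS 2012 Theorem 5 `udisjShift_nonnegRank_explicit`. [cite: BraunEtAl2012, Thm 5 (§3.2, pp. 11–12)] -/
theorem pencil_visible {k : ℕ} (hmn : 2 * m ≤ n) (hk : 4 * k + 3 ≤ m) (lam : ℝ) (hlam : 0 ≤ lam)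
    (hsmall : lam * (m : ℝ) ^ 2 ≤ 2) {S : Type*} [Fintype S]
    (U : Finset (Fin n) → S → ℝ) (V : Finset (Fin n) × Equiv.Perm (Fin n) → S → ℝ)
    (hU : ∀ a s, 0 ≤ U a s) (hV : ∀ bπ s, 0 ≤ V bπ s) (hfac : ∀ a bπ, pencil n lam a bπ = ∑ s, U a s * V bπ s) :
    Real.exp ((k + 1 : ℝ) / 576) ≤ 64 * (k + 1) * Fintype.card S := by
  classical
  set ρ : ℝ := 1 + lam * (m : ℝ) ^ 2 / 2 with hρ
  have hρ1 : 1 ≤ ρ := by rw [hρ]; nlinarith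
  have hρ2 : ρ ≤ 2 := by rw [hρ]; linarith
  have hkm : 4 * k + 3 ≤ Fintype.card (Fin m) := by rwa [Fintype.card_fin]
  -- the averaged matrix on `Finset (Fin m)`
  have key := udisjShift_nonnegRank_explicit (α := Fin m) hkm hρ1
    (fun a b => ((1 : ℝ) - ((a ∩ b).card : ℝ)) ^ 2 + lam * (m : ℝ) ^ 2 / 2)
    (fun a b hab => by
      rw [Finset.disjoint_iff_inter_eq_empty.1 hab, Finset.card_empty, hρ]; push_cast; ring)
    (fun a b hab => by rw [hab, hρ]; push_cast; ring)
    (fun a s => U (rowEmb hmn a) s)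
    (fun b s => (V (colEmb hmn b, 1) s + V (colEmb hmn b, revPerm hmn) s) / 2)
    (fun a s => hU _ _) (fun b s => by have := hV (colEmb hmn b, 1) s; have := hV (colEmb hmn b, revPerm hmn) s; linarith)
    (fun a b => by
      have h1 := hfac (rowEmb hmn a) (colEmb hmn b, 1)
      have h2 := hfac (rowEmb hmn a) (colEmb hmn b, revPerm hmn)
      unfold pencil at h1 h2
      dsimp only at h1 h2
      rw [rowEmb_inter_colEmb_card] at h1 h2
      have hs := inv_pair_sum hmn a
      have : ∑ s, U (rowEmb hmn a) s * ((V (colEmb hmn b, 1) s + V (colEmb hmn b, revPerm hmn) s) / 2)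
          = (∑ s, U (rowEmb hmn a) s * V (colEmb hmn b, 1) s + ∑ s, U (rowEmb hmn a) s * V (colEmb hmn b, revPerm hmn) s) / 2 := by
        rw [← Finset.sum_add_distrib, Finset.sum_div]
        refine Finset.sum_congr rfl fun s _ => ?_
        ring
      rw [this, ← h1, ← h2]
      linear_combination (-lam / 2) * hs)
  -- weaken `ρ` to `2`
  have hexp : Real.exp ((k + 1 : ℝ) / 576) ≤ Real.exp ((k + 1 : ℝ) / (144 * ρ ^ 2)) := by
    apply Real.exp_le_exp.2
    have h144 : 144 * ρ ^ 2 ≤ 576 := by nlinarith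
    exact div_le_div_of_nonneg_left (by positivity) (by positivity) h144
  have hS0 : (0 : ℝ) ≤ Fintype.card S := by positivity
  calc Real.exp ((k + 1 : ℝ) / 576) ≤ Real.exp ((k + 1 : ℝ) / (144 * ρ ^ 2)) := hexp
    _ ≤ 32 * (k + 1) * ρ * Fintype.card S := key
    _ ≤ 32 * (k + 1) * 2 * Fintype.card S := by gcongr
    _ = 64 * (k + 1) * Fintype.card S := by ring

/-- T3 in the tree's currency: `HasNonnegFactorization (pencil n λ) r → e^{(k+1)/576} ≤ 64(k+1)·r` under the same side conditions —
with T1 (`hasNonnegFactorization_pencil_poly`) the nonnegative rank of `M_λ^{(n)}` is `n^{O(1/λ)}` and `2^{Ω(min(n, λ^{−1/2}))}`. -/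
theorem pencil_visible_rank {k : ℕ} (hmn : 2 * m ≤ n) (hk : 4 * k + 3 ≤ m) (lam : ℝ) (hlam : 0 ≤ lam)
    (hsmall : lam * (m : ℝ) ^ 2 ≤ 2) {r : ℕ} (h : HasNonnegFactorization (pencil n lam) r) :
    Real.exp ((k + 1 : ℝ) / 576) ≤ 64 * (k + 1) * r := by
  obtain ⟨U, V, hU, hV, hM⟩ := h
  have := pencil_visible hmn hk lam hlam hsmall U (fun bπ s => V s bπ) hU (fun bπ s => hV s bπ) hM
  simpa using this

end Visible

/-! ## §7 THEOREM T4 (kernel): for ROW-SYMMETRIC certificates the window is CLOSED — symmetric `rank₊ M_λ = n^{Θ(1/λ)}` (memo T4)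

A nonnegative factorisation `M_λ[a;(b,π)] = Σ_s U_s(a)·V_s(b,π)` is ROW-SYMMETRIC if every `σ ∈ S_n` acting on the rows (`a ↦ σ(a)`) is
compensated by a permutation `τ_σ` of the slots, `U_{τ_σ s}(σ a) = U_s(a)` (Yannakakis' symmetric extended formulations, read on the row factor;
only the row half of the symmetry is used).  The conjunction certificate of T1 is row-symmetric (`pencil_symm_upper`: `S_n` permutes the slots
`(k, S, T′) ↦ (k, σS, σT′)`).  Conversely, if a row-symmetric factorisation has FEWER than `C(n, D+1)` slots (`n > 8`, `4(D+1) ≤ n`), the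
Chan–Lee–Raghavendra–Steurer Lemma 4.2 (= Yannakakis' Lemma / Dixon–Mortimer Thm 5.2B, PROVED in the tree:
`Literature.Combinatorics.Optimization.ChanEtAl2016_lemma42` over `Literature.GroupTheory.PermutationGroups.alternating_fixing_le_of_index_lt_choose`)
makes every row function `U_s` depend only on `a ∩ X_s` and `|a|` for some `|X_s| ≤ D` (`rowSymmetric_junta`); on a size class it is then a
nonnegative combination of the atoms `[a ∩ X_s = W] = cj W (X_s ∖ W)` of degree `|X_s| ≤ D` (`cj_inter_eq`), so every column of `M_λ` restricted to
the `2D`-slice lies in `cone_D` — which T2 (`slice_cone_lower_quarter`) forbids when `λ < 1/(4D)`.  Hence (`pencil_symm_lower`): below `λ = 1/(4D)`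
a row-symmetric certificate needs `≥ C(n, D+1)` slots, i.e. symmetric `rank₊ M_λ ≥ C(n, min(⌊n/4⌋, ⌈1/(4λ)⌉)) = n^{Ω(min(n, 1/λ))}`, matching T1's
row-symmetric `(n+1)^{4⌈2/λ⌉+1}`: FOR SYMMETRIC CERTIFICATES `Q^Π_λ` IS VISIBLE IFF `λ → 0` (no window); the residual S2 window `[c/log² n, o(1)]`
of §6 concerns ASYMMETRIC slots only.  [cite: ChanEtAl2016, Lemma 4.2 (arXiv:1309.0563v3 p. 12); Yannakakis1991, symmetric case] -/

section Symmetric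

/-- ROW-SYMMETRIC slot families: every `σ ∈ S_n` acting on the rows is compensated by a permutation of the slots. -/
def RowSymmetric {S : Type*} (U : Finset (Fin n) → S → ℝ) : Prop :=
  ∀ σ : Equiv.Perm (Fin n), ∃ τ : Equiv.Perm S,
    ∀ (a : Finset (Fin n)) (s : S), U (a.map σ.toEmbedding) (τ s) = U a s

/-! ### T4, upper half: the conjunction certificate of T1 is row-symmetric -/

/-- `S_n` acts on the slots: `(k, S, T′) ↦ (k, σS, σT′)` -/
def slotPerm (σ : Equiv.Perm (Fin n)) : Equiv.Perm (Slot n) :=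
  Equiv.prodCongr (Equiv.refl _) (Equiv.prodCongr σ.finsetCongr σ.finsetCongr)

theorem slotPerm_apply (σ : Equiv.Perm (Fin n)) (s : Slot n) :
    slotPerm σ s = (s.1, (s.2.1.map σ.toEmbedding, s.2.2.map σ.toEmbedding)) := by
  obtain ⟨k, S, T⟩ := s
  simp [slotPerm]

/-- conjunctions are equivariant: `cj (σS) (σT) (σa) = cj S T a` -/
theorem cj_map (σ : Equiv.Perm (Fin n)) (S T a : Finset (Fin n)) :
    cj (S.map σ.toEmbedding) (T.map σ.toEmbedding) (a.map σ.toEmbedding) = cj S T a := by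
  unfold cj
  by_cases h : S ⊆ a ∧ Disjoint T a
  · rw [if_pos h, if_pos]
    exact ⟨Finset.map_subset_map.mpr h.1, (Finset.disjoint_map _).mpr h.2⟩
  · rw [if_neg h, if_neg]
    exact fun h' => h ⟨Finset.map_subset_map.mp h'.1, (Finset.disjoint_map _).mp h'.2⟩

/-- the explicit row functions of T1: `U a (k, S, T′) = [|a| = k]·[|S|+|T′| ≤ 2T]·cj S T′ a` -/
def rowSlot (T : ℕ) (a : Finset (Fin n)) (s : Slot n) : ℝ :=
  if a.card = (s.1 : ℕ) ∧ s.2.1.card + s.2.2.card ≤ 2 * T then cj s.2.1 s.2.2 a else 0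

theorem rowSlot_nonneg (T : ℕ) (a : Finset (Fin n)) (s : Slot n) : 0 ≤ rowSlot T a s := by
  unfold rowSlot
  split_ifs
  · exact cj_nonneg _ _ _
  · exact le_rfl

theorem rowSlot_eq_zero (T : ℕ) (a : Finset (Fin n)) (s : Slot n) (h : ¬ s.2.1.card + s.2.2.card ≤ 2 * T) :
    rowSlot T a s = 0 := by
  unfold rowSlot
  rw [if_neg (fun h' => h h'.2)]

theorem rowSlot_map (T : ℕ) (σ : Equiv.Perm (Fin n)) (a : Finset (Fin n)) (s : Slot n) :
    rowSlot T (a.map σ.toEmbedding) (slotPerm σ s) = rowSlot T a s := by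
  rw [slotPerm_apply]
  unfold rowSlot
  simp only [Finset.card_map, cj_map]

/-- `S_n` acts on the live slots (the degree `|S|+|T′|` is preserved) -/
def liveSlotPerm (T : ℕ) (σ : Equiv.Perm (Fin n)) : Equiv.Perm (LiveSlot n T) :=
  (slotPerm σ).subtypeEquiv (fun s => by rw [slotPerm_apply]; simp only [Finset.card_map])

/-- the row identity of T1 for the explicit row functions (all slots) -/
theorem rowSlot_factor (lam : ℝ) (hlam : 0 < lam) (T : ℕ) (hT : 2 ≤ lam * T) :
    ∃ V : Finset (Fin n) × Equiv.Perm (Fin n) → Slot n → ℝ, (∀ bπ s, 0 ≤ V bπ s) ∧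
      ∀ (a b : Finset (Fin n)) (π : Equiv.Perm (Fin n)),
        ((1 : ℝ) - ((a ∩ b).card : ℝ)) ^ 2 + lam * (inv a π : ℝ) = ∑ s, rowSlot T a s * V (b, π) s := by
  classical
  choose cf h0 hd he using
    fun (π : Equiv.Perm (Fin n)) (k : ℕ) (b : Finset (Fin n)) => col_cert (lam := lam) π k b hlam hT
  refine ⟨fun bπ s => cf bπ.2 (s.1 : ℕ) bπ.1 s.2, fun bπ s => h0 _ _ _ _, ?_⟩
  intro a b π
  have hkn : a.card < n + 1 := by
    have : a.card ≤ n := by simpa using Finset.card_le_univ a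
    omega
  unfold rowSlot
  rw [Fintype.sum_prod_type, Finset.sum_eq_single (⟨a.card, hkn⟩ : Fin (n + 1))]
  · rw [he π a.card b a rfl]
    refine Finset.sum_congr rfl fun p _ => ?_
    dsimp only
    by_cases hp : p.1.card + p.2.card ≤ 2 * T
    · simp only [hp, and_true, if_true]
      ring
    · have hz := hd π a.card b p (by omega)
      simp [hp, hz]
  · intro k _ hk
    have hne : a.card ≠ (k : ℕ) := fun e => hk (Fin.ext e.symm)
    simp [hne]
  · intro h
    exact absurd (Finset.mem_univ _) h

/-- ★ **THEOREM T4, upper half (kernel): the polynomial certificate of T1 is ROW-SYMMETRIC.**  For `λT ≥ 2` there is a row-symmetric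
nonnegative factorisation of `M_λ^{(n)}` through the live slots (`≤ (n+1)^{4T+1}` of them, `card_liveSlot_le`). -/
theorem pencil_symm_upper (n : ℕ) (lam : ℝ) (hlam : 0 < lam) (T : ℕ) (hT : 2 ≤ lam * T) :
    ∃ (U : Finset (Fin n) → LiveSlot n T → ℝ) (V : Finset (Fin n) × Equiv.Perm (Fin n) → LiveSlot n T → ℝ),
      (∀ a s, 0 ≤ U a s) ∧ (∀ bπ s, 0 ≤ V bπ s) ∧ RowSymmetric U ∧
      ∀ a bπ, pencil n lam a bπ = ∑ s, U a s * V bπ s := by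
  classical
  obtain ⟨V, hV, hM⟩ := rowSlot_factor (n := n) lam hlam T hT
  refine ⟨fun a s => rowSlot T a s.1, fun bπ s => V bπ s.1, fun a s => rowSlot_nonneg T a s.1, fun bπ s => hV _ _,
    fun σ => ⟨liveSlotPerm T σ, fun a s => rowSlot_map T σ a s.1⟩, ?_⟩
  rintro a ⟨b, π⟩
  show pencil n lam a (b, π) = ∑ s : LiveSlot n T, rowSlot T a s.1 * V (b, π) s.1
  unfold pencil
  rw [hM a b π, ← Finset.sum_filter_of_ne (p := fun s : Slot n => s.2.1.card + s.2.2.card ≤ 2 * T)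
    (fun s _ hs => by
      by_contra hc
      exact left_ne_zero_of_mul hs (rowSlot_eq_zero T a s hc))]
  exact Finset.sum_subtype _ (fun s => by simp) _

/-! ### T4, lower half: a row-symmetric certificate with fewer than `C(n, D+1)` slots forces `λ ≥ 1/(4D)` -/

/-- the Boolean-cube rendering of a row, `x_a(j) = [j ∈ a]`, and back -/
def toCube (a : Finset (Fin n)) : Fin n → Bool := fun j => decide (j ∈ a)

/-- … and back -/
def ofCube (x : Fin n → Bool) : Finset (Fin n) := Finset.univ.filter (fun j => x j = true)

theorem ofCube_toCube (a : Finset (Fin n)) : ofCube (toCube a) = a := by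
  ext j; simp [ofCube, toCube]

theorem ofCube_comp_symm (x : Fin n → Bool) (σ : Equiv.Perm (Fin n)) :
    ofCube (x ∘ ⇑σ.symm) = (ofCube x).map σ.toEmbedding := by
  ext j; simp [ofCube, Finset.mem_map_equiv]

theorem card_filter_toCube (a : Finset (Fin n)) :
    (Finset.univ.filter fun j => toCube a j = true).card = a.card := by
  congr 1; ext j; simp [toCube]

/-- **CLRS Lemma 4.2 for row-symmetric slot families** (the tree's PROVED `ChanEtAl2016_lemma42` = Yannakakis / Dixon–Mortimer 5.2B, transported
from the cube `{0,1}ⁿ` to `Finset (Fin n)`): fewer than `C(n,d)` row-symmetric slots (`n > 8`, `1 ≤ d`, `4d ≤ n`) ⇒ every row function `U_s`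
depends only on `a ∩ X_s` and `|a|`, for some `|X_s| < d`. -/
theorem rowSymmetric_junta {d : ℕ} (hn : 8 < n) (hd : 1 ≤ d) (h4d : 4 * d ≤ n) {S : Type*} [Fintype S]
    (U : Finset (Fin n) → S → ℝ) (hsym : RowSymmetric U) (hS : Fintype.card S < n.choose d) (s : S) :
    ∃ X : Finset (Fin n), X.card < d ∧
      ∀ a a' : Finset (Fin n), a ∩ X = a' ∩ X → a.card = a'.card → U a s = U a' s := by
  classical
  set R := Fintype.card S with hR
  let e : S ≃ Fin R := Fintype.equivFin S
  let q : Fin R → (Fin n → Bool) → ℝ := fun i x => U (ofCube x) (e.symm i)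
  have hclosed : ∀ σ : Equiv.Perm (Fin n), ∃ π : Equiv.Perm (Fin R), ∀ (i : Fin R) (x : Fin n → Bool),
      q (π i) (x ∘ ⇑σ.symm) = q i x := by
    intro σ
    obtain ⟨τ, hτ⟩ := hsym σ
    refine ⟨(e.symm.trans τ).trans e, fun i x => ?_⟩
    show U (ofCube (x ∘ ⇑σ.symm)) (e.symm (e (τ (e.symm i)))) = U (ofCube x) (e.symm i)
    rw [e.symm_apply_apply, ofCube_comp_symm, hτ]
  obtain ⟨X, hXd, hX⟩ :=
    Literature.Combinatorics.Optimization.ChanEtAl2016_lemma42 hclosed hn hd h4d (hR ▸ hS) (e s)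
  refine ⟨X, hXd, fun a a' hX' hcard => ?_⟩
  have hag : ∀ j ∈ X, toCube a j = toCube a' j := by
    intro j hj
    have hiff : j ∈ a ↔ j ∈ a' := by
      constructor
      · intro hja
        have h2 : j ∈ a' ∩ X := hX' ▸ Finset.mem_inter.mpr ⟨hja, hj⟩
        exact (Finset.mem_inter.mp h2).1
      · intro hja
        have h2 : j ∈ a ∩ X := hX'.symm ▸ Finset.mem_inter.mpr ⟨hja, hj⟩
        exact (Finset.mem_inter.mp h2).1
    simp [toCube, hiff]
  have h := Literature.Combinatorics.Optimization.eq_of_agree_of_card_eq (hX) hag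
    (by rw [card_filter_toCube, card_filter_toCube, hcard])
  simpa [q, ofCube_toCube] using h

/-- on any row, the degree-`|X|` atom `cj W (X ∖ W)` (`W ⊆ X`) is the indicator `[a ∩ X = W]` -/
theorem cj_inter_eq (X W a : Finset (Fin n)) (hW : W ⊆ X) : cj W (X \ W) a = if a ∩ X = W then 1 else 0 := by
  unfold cj
  by_cases h : a ∩ X = W
  · rw [if_pos h, if_pos]
    refine ⟨?_, ?_⟩
    · rw [← h]; exact Finset.inter_subset_left
    · rw [← h]
      exact Finset.disjoint_left.mpr (fun j hj hja =>
        (Finset.mem_sdiff.mp hj).2 (Finset.mem_inter.mpr ⟨hja, (Finset.mem_sdiff.mp hj).1⟩))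
  · rw [if_neg h, if_neg]
    rintro ⟨hWa, hdisj⟩
    apply h
    ext j
    simp only [Finset.mem_inter]
    constructor
    · rintro ⟨hja, hjX⟩
      by_contra hjW
      exact Finset.disjoint_left.mp hdisj (Finset.mem_sdiff.mpr ⟨hjX, hjW⟩) hja
    · intro hjW
      exact ⟨hWa hjW, hW hjW⟩

/-- ★★★ **THEOREM T4 (kernel), lower half: ROW-SYMMETRIC certificates need `C(n, D+1)` slots below `λ = 1/(4D)`.**  If `n > 8`,
`1 ≤ D`, `4(D+1) ≤ n`, `0 ≤ λ < 1/(4D)` and `M_λ^{(n)} = Σ_s U_s ⊗ V_s` is a nonnegative factorisation whose row factor is row-symmetric, then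
`|S| ≥ C(n, D+1)`.  Reading (with T1/`pencil_symm_upper`): the least number of slots of a ROW-SYMMETRIC nonnegative factorisation of `M_λ^{(n)}` is
`n^{Θ(min(n, 1/λ))}` — superpolynomial iff `λ → 0`; the S2 window is closed for symmetric certificates. -/
theorem pencil_symm_lower {D : ℕ} (hn : 8 < n) (hD : 1 ≤ D) (h4D : 4 * (D + 1) ≤ n) (lam : ℝ) (hlam : 0 ≤ lam)
    (hsmall : lam < 1 / (4 * (D : ℝ))) {S : Type*} [Fintype S]
    (U : Finset (Fin n) → S → ℝ) (V : Finset (Fin n) × Equiv.Perm (Fin n) → S → ℝ)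
    (hU : ∀ a s, 0 ≤ U a s) (hV : ∀ bπ s, 0 ≤ V bπ s) (hsym : RowSymmetric U)
    (hfac : ∀ a bπ, pencil n lam a bπ = ∑ s, U a s * V bπ s) :
    n.choose (D + 1) ≤ Fintype.card S := by
  classical
  by_contra hlt
  push Not at hlt
  -- junta structure of every row function (CLRS Lemma 4.2)
  choose X hXd hXU using fun s => rowSymmetric_junta hn (by omega) h4D U hsym hlt s
  have hkn : 2 * D + 2 * D ≤ n := by omega
  -- the column of T2: cut `k = 2D`, the `2D` outsider positions nearest the cut, `π = 1`
  obtain ⟨coef, hcoef⟩ : ∃ coef : S → Finset (Fin n) → ℝ, ∀ s W, coef s W =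
      if h : ∃ a' : Finset (Fin n), a'.card = 2 * D ∧ a' ∩ X s = W then U h.choose s else 0 := ⟨_, fun _ _ => rfl⟩
  have hcoef0 : ∀ s W, 0 ≤ coef s W := by
    intro s W
    rw [hcoef]
    split_ifs
    · exact hU _ _
    · exact le_rfl
  obtain ⟨g, hg_def⟩ : ∃ g : Finset (Fin n) → ℝ, ∀ a, g a =
      ∑ s, V (cutCol (1 : Equiv.Perm (Fin n)) (2 * D) (2 * D), 1) s *
        ∑ W ∈ (X s).powerset, coef s W * cj W (X s \ W) a := ⟨_, fun _ => rfl⟩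
  have hg : InCone D g := by
    refine (InCone.sum Finset.univ
      (fun s a => V (cutCol (1 : Equiv.Perm (Fin n)) (2 * D) (2 * D), 1) s *
        ∑ W ∈ (X s).powerset, coef s W * cj W (X s \ W) a)
      (fun s _ => InCone.smul (hV _ _) (InCone.sum (X s).powerset (fun W a => coef s W * cj W (X s \ W) a)
        (fun W hW => InCone.atom (hcoef0 s W) ?_)))).congr (fun a => (hg_def a).symm)
    have hWX : W ⊆ X s := Finset.mem_powerset.mp hW
    have h1 : W.card + (X s \ W).card = (X s).card := by
      rw [add_comm]; exact Finset.card_sdiff_add_card_eq_card hWX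
    have h2 := hXd s
    omega
  have hslice : ∀ a : Finset (Fin n), a.card = 2 * D →
      ((1 : ℝ) - ((a ∩ cutCol (1 : Equiv.Perm (Fin n)) (2 * D) (2 * D)).card : ℝ)) ^ 2 + lam * (inv a 1 : ℝ) = g a := by
    intro a ha
    have h1 := hfac a (cutCol (1 : Equiv.Perm (Fin n)) (2 * D) (2 * D), 1)
    simp only [pencil] at h1
    rw [h1, hg_def]
    refine Finset.sum_congr rfl (fun s _ => ?_)
    rw [Finset.sum_eq_single (a ∩ X s)]
    · have hex : ∃ a' : Finset (Fin n), a'.card = 2 * D ∧ a' ∩ X s = a ∩ X s := ⟨a, ha, rfl⟩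
      have hc : coef s (a ∩ X s) = U a s := by
        rw [hcoef, dif_pos hex]
        exact hXU s _ _ hex.choose_spec.2 (hex.choose_spec.1.trans ha.symm)
      rw [cj_inter_eq _ _ _ Finset.inter_subset_right, if_pos rfl, hc]
      ring
    · intro W hW hne
      rw [cj_inter_eq _ _ _ (Finset.mem_powerset.mp hW), if_neg (fun h => hne h.symm)]
      ring
    · intro h
      exact absurd (Finset.mem_powerset.mpr Finset.inter_subset_right) h
  have hq := slice_cone_lower_quarter (1 : Equiv.Perm (Fin n)) (2 * D) D lam hlam hD le_rfl hkn ⟨g, hg, hslice⟩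
  linarith

/-- COROLLARY (the symmetric nonnegative rank in the tree's currency): a row-symmetric factorisation of `M_λ^{(n)}` of size `r` with
`r < C(n, D+1)`, `n > 8`, `4(D+1) ≤ n` forces `λ ≥ 1/(4D)`. -/
theorem pencil_symm_lower' {D : ℕ} (hn : 8 < n) (hD : 1 ≤ D) (h4D : 4 * (D + 1) ≤ n) (lam : ℝ) (hlam : 0 ≤ lam)
    {S : Type*} [Fintype S]
    (U : Finset (Fin n) → S → ℝ) (V : Finset (Fin n) × Equiv.Perm (Fin n) → S → ℝ)
    (hU : ∀ a s, 0 ≤ U a s) (hV : ∀ bπ s, 0 ≤ V bπ s) (hsym : RowSymmetric U)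
    (hfac : ∀ a bπ, pencil n lam a bπ = ∑ s, U a s * V bπ s) (hS : Fintype.card S < n.choose (D + 1)) :
    1 / (4 * (D : ℝ)) ≤ lam := by
  by_contra h
  push Not at h
  exact absurd (pencil_symm_lower hn hD h4D lam hlam h U V hU hV hsym hfac) (not_le.mpr hS)

end Symmetric

end

end Summit.ValiantsHypothesis.ValiantsHypothesis.Cruxes.NNDivisionHard.RealLambda39
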